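import Literature.Probability.Percolation.TwoGhostInequality
import Literature.Probability.Percolation.ClusterExploration
import Literature.Probability.Percolation.FiniteEnergy
import Literature.Probability.Percolation.ConnectivityProofs
import Literature.Probability.Percolation.BondPercolationSymmetry
import HarnessLib

/-!
# Proof of Hutchcroft's two-ghost inequality in ghost-free form on `ℤ^d` (Corollary 1.7)

Topic `Probability/Percolation`; namespace `Literature.Probability.Percolation`. This file
DISCHARGES the named fact `Hutchcroft2020_twoGhost_corollary` of `TwoGhostInequality.lean`
(T. Hutchcroft, *Locality of the critical probability for transitive graphs of exponential
growth*, Ann. Probab. 48 (2020) 1352–1371, arXiv:1808.08940, Corollary 1.7, p. 6), typed there for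
nearest-neighbour bond percolation on `ℤ^d`:

* `Hutchcroft2020_twoGhost_corollary_holds : Hutchcroft2020_twoGhost_corollary` — for `d ≥ 1`,
  `p ∈ (0, 1]`, `n ≥ 1` and an edge `e = {x, y}` of `ℤ^d`,
  `P_p(e closed, x ↮ y, |E(C(x))| ≥ n, |E(C(y))| ≥ n, C(x) or C(y) finite) ≤ 66·(2d)·√((1-p)/(pn))`.
  We obtain the constant `32·d ≤ 66·2d` (`TwoGhost.measureReal_twoArm_le`).

## The printed proof (§3 of the source, read on the held text, arXiv pp. 8–9) and this file

Hutchcroft proves Thm. 1.6 (`P_{p,h}(T_e) ≤ 33 d √((1-p)h/p)`, ghost field of intensity `h`)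
and deduces Cor. 1.7 by positive association of the ghost field and the choice `h = c/n`.
The proof of Thm. 1.6 has two halves:

1. **Lemma 3.1** (Aizenman–Kesten–Newman exchange of summation): the pointwise identity (3.1)
   counting the finite clusters touching `e` and the ghost field, the resampling of the edge `e`
   ((3.3): "`F_e ∩ G_e` is independent of the value of `ω(e)`"), and the **mass-transport
   principle** for the unimodular transitive graph ((3.5)–(3.6)), giving
   `P(T_e) ≤ (2 deg(o)/p) E[|h_p(K_o)|/|E(K_o)| ; K_o finite, touches a green edge]`,
   `h_p(K) = p|∂K| - (1-p)|E_∘(K)|`.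
2. **Proof of Thm. 1.6**: the edge-by-edge exploration of `K_v` with its martingale
   `Z_n = (1-p)|O_n| - p|C_n|`, `Z_T = -h_p(K_v)`, `T = |E(K_v)|`, `E Z_n² = p(1-p)E[T ∧ n] ≤ p(1-p)n`,
   a dyadic decomposition and Doob's `L²` maximal inequality ((3.7)–(3.8)).

This file follows that architecture on `G = ℤ^d` (a Cayley graph of the amenable group `ℤ^d`,
hence unimodular; the automorphisms used are the translations, which act transitively on the
vertices, and the mass-transport principle for them is a reindexing of absolutely convergent
sums over `ℤ^d`, `TwoGhost.edge_vertex_mass_transport`), with three simplifications that only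
affect constants (all in our favour):

* **The ghost field is integrated out from the start.** Conditionally on `ω`, a finite cluster
  `K` touches a green edge with probability `w(K) = 1 - e^{-h|E(K)|}`; every ghost quantity of
  §3 is replaced by this deterministic weight (`TwoGhost.wt`, with `h = 1/n`). Positive
  association of the ghost field (proof of Cor. 1.7) becomes the pointwise inequality
  `1 - w(|A ∪ B|) ≥ (1 - w|A|)(1 - w|B|)` (`TwoGhost.wt_mul_add_le`), and the identity (3.4)
  "up to a null set" becomes a pointwise INEQUALITY (`TwoGhost.Tgt_add_le`), so no null sets and
  no second probability space are needed.
* **Vertex form of the transport.** Mass is sent from an edge to the VERTICES of the finite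
  clusters touching it (density `w(K)/|K|`, `TwoGhost.Vw`) rather than to their edges; this roots
  the resulting bound at the vertex `x` directly and costs the factor `|E(K)| ≤ 2d|K|`
  (`TwoGhost.ncard_touch_le`) in place of Hutchcroft's `deg(o)`.
* **No maximal inequality.** Since `Z` is already stopped at `T`, `|Z_T| 1(T ≤ N) = |Z_N| 1(T ≤ N)`,
  so `E[h_p(K)²; |E(K)| ≤ N] ≤ E Z_N² ≤ p(1-p)N` (`TwoGhost.lintegral_sq_hp_le`, from the tree's
  `ClusterExploration` decision tree, Part A below); Cauchy–Schwarz with the weight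
  `min(1/n, 1/t)²` and a summation by parts (`TwoGhost.lintegral_weight_le`,
  `TwoGhost.tsum_min_inv_sq_le`) then give `E[w(K)|h_p(K)|/|K|; K finite] ≤ 2d √(2p(1-p)/n)`
  (`TwoGhost.lintegral_F4_sq_le`), replacing the dyadic Doob argument.

Assembly (`TwoGhost.measureReal_twoArm_le`): `w(n)² P(S_{e,n}) ≤ E[Tgt_e] ≤ Σ_{e' ∋ x} E[Tgt_{e'}]
≤ (2/p)·E[w|h_p|/|K|] ≤ (2/p)·2d·√(2p(1-p)/n)` and `w(n) = 1 - e^{-1} ≥ 1/2`, whence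
`P(S_{e,n}) ≤ 32 d √((1-p)/(pn))`.

## Contents

* Part A (`namespace ClusterExploration`, general locally finite graph): the one-step expectation
  formula for the tree's exploration `ClusterExploration.run` (`integral_comp_run_succ`), the score
  `score = (1-p)·#open - p·#closed`, `E[Z_N²] = p(1-p) Σ_{k<N} P(not halted at k) ≤ p(1-p)N`
  (`integral_score_sq_le`), and the identification of the terminal score with `-h_p(C(o))` when
  `|E(C(o))| ≤ N` (`score_run_eq`).
* Part B (`namespace TwoGhost`): the edge–vertex mass-transport principle on `ℤ^d`; telescoping,
  summation by parts and Cauchy–Schwarz in `ℝ≥0∞`.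
* Part C: clusters and the edges they touch (`touch` = `E(K)`), the flip lemma
  `C(a) ∪ C(b)` is unchanged by flipping `{a,b}` (`union_openCluster_insert_eq`), the countably
  valued finite-cluster data `cdata` and the measurability it provides, resampling one edge
  (`lintegral_mem_mul_of_flip`, from `bondPercolation_indep_edgeSigma`), edge labels
  `(v, i) ↦ {v, v + eᵢ}` of `ℤ^d`, degree bound, translation covariance (`shiftConfig`, from
  `bondPercolation_map_shift` and `openCluster_relabel_shift`).
* Part D: Steps 1–6 of the argument above and the discharge.

Everything here is proved; no new named fact is introduced. Measurability side conditions are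
discharged through `cdata` (a measurable map into a countable discrete space), so that every
integrand is a composition of `cdata` at one or two vertices with indicator events.

## References

* T. Hutchcroft, Ann. Probab. 48 (2020) 1352–1371, arXiv:1808.08940: §1.1 (Thm. 1.6, Cor. 1.7,
  Rem. 1.8), §2 (mass transport, (2.1)–(2.2)), §3 (Lemma 3.1, (3.1)–(3.8), proofs of Thm. 1.6 and
  Cor. 1.7). [Hutchcroft2020Locality]
* M. Aizenman, H. Kesten, C. M. Newman, Comm. Math. Phys. 111 (1987) 505–531 (the summation
  exchange). [AizenmanKestenNewman1987]
* G. Grimmett, *Percolation*, 2nd ed. (1999), §1.3 (product measure), §2.2 (events of finitely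
  many edges). [GrimmettPercolation1999]
-/

noncomputable section

namespace Literature.Probability.Percolation

open _root_.MeasureTheory _root_.ProbabilityTheory _root_.Filter
open scoped ENNReal Topology

/-! ## Part A. The exploration martingale (Hutchcroft 2020, proof of Thm. 1.6) -/

namespace ClusterExploration

variable {V : Type*} [DecidableEq V] {G : SimpleGraph V} [G.LocallyFinite] {n : ℕ}

/-! ### One more step: counts after an extension -/

/-- Extending a state by the answer `b` adds one open answer iff `b = true`. [folklore] -/
theorem numOpen_extend {σ : State V} (h : ¬ Halted G n σ) (b : Bool) :
    numOpen (extend G n σ h b) = numOpen σ + (if b then 1 else 0) := by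
  simp only [numOpen, hist_extend, List.filter_append, List.length_append]
  cases b <;> simp

/-- Extending a state by the answer `b` adds one closed answer iff `b = false`. [folklore] -/
theorem numClosed_extend {σ : State V} (h : ¬ Halted G n σ) (b : Bool) :
    numClosed (extend G n σ h b) = numClosed σ + (if b then 0 else 1) := by
  simp only [numClosed, hist_extend, List.filter_append, List.length_append]
  cases b <;> simp

/-- The atom `{run = σ}` refined by the answer `b` to the next query is the cylinder of the
extended history. [folklore] -/
theorem setOf_run_eq_inter_answer_eq_cyl {o : V} {k : ℕ} {σ : State V} (hσ : σ ∈ support G n o k)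
    (h : ¬ Halted G n σ) (b : Bool) :
    {ω | run G n o ω k = σ} ∩ {ω | (nextEdge G n σ h ∈ ω ↔ b = true)} =
      cyl (extend G n σ h b).hist := by
  rw [setOf_run_eq_of_mem_support hσ, hist_extend]
  ext ω
  simp only [cyl, Set.mem_inter_iff, Set.mem_setOf_eq, List.mem_append, List.mem_singleton]
  constructor
  · rintro ⟨h1, h2⟩ eb (heb | rfl)
    · exact h1 eb heb
    · exact h2
  · intro hall
    exact ⟨fun eb heb => hall eb (Or.inl heb), hall _ (Or.inr rfl)⟩

/-- The probability of the atom refined by the answer `b`: a factor `p` (open) or `1 - p` (closed).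
[cite: Hutchcroft2020Locality, §3, proof of Thm. 1.6] -/
theorem real_run_eq_inter_answer (p : unitInterval) {o : V} {k : ℕ} {σ : State V}
    (hσ : σ ∈ support G n o k) (h : ¬ Halted G n σ) (b : Bool) :
    (bondPercolation G p).real ({ω | run G n o ω k = σ} ∩ {ω | (nextEdge G n σ h ∈ ω ↔ b = true)}) =
      (if b then (p : ℝ) else 1 - p) * (bondPercolation G p).real {ω | run G n o ω k = σ} := by
  rw [setOf_run_eq_inter_answer_eq_cyl hσ h b, real_run_eq p hσ]
  obtain ⟨ω₀, hI⟩ := inv_of_mem_support hσ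
  have hnd : ((extend G n σ h b).hist.map Prod.fst).Nodup := by
    rw [hist_extend, List.map_append, List.nodup_append]
    refine ⟨hI.nodup, by simp, ?_⟩
    intro x hx y hy
    simp only [List.map_cons, List.map_nil, List.mem_singleton] at hy
    subst hy
    rintro rfl
    exact (nextEdge_spec h).2 (mem_queried_iff.2 (by simpa using hx))
  have hE : ∀ eb ∈ (extend G n σ h b).hist, eb.1 ∈ G.edgeSet := by
    intro eb heb
    rw [hist_extend, List.mem_append, List.mem_singleton] at heb
    rcases heb with heb | rfl
    · exact (hI.queried_spec eb.1 (mem_queried_iff.2 ⟨eb.2, heb⟩)).1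
    · exact nextEdge_mem_edgeSet h
  rw [real_cyl p hnd hE, hist_extend]
  simp only [List.filter_append, List.length_append]
  cases b <;> simp [numOpen, numClosed, pow_succ] <;> ring

open Classical in
/-- **One-step expectation formula**: the expectation of a function of the state after `k + 1`
steps, as a sum over the states after `k` steps (halted states are kept, the others branch with
probabilities `p` / `1 - p`). [cite: Hutchcroft2020Locality, §3, proof of Thm. 1.6] -/
theorem integral_comp_run_succ (p : unitInterval) (o : V) (k : ℕ) (g : State V → ℝ) :
    ∫ ω, g (run G n o ω (k + 1)) ∂(bondPercolation G p) =
      ∑ σ ∈ support G n o k,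
        (if h : Halted G n σ then g σ
         else (p : ℝ) * g (extend G n σ h true) + (1 - p) * g (extend G n σ h false)) *
          (bondPercolation G p).real {ω | run G n o ω k = σ} := by
  set P := bondPercolation G p with hP
  -- pointwise decomposition along the atoms of time `k`
  have hpt : ∀ ω, g (run G n o ω (k + 1)) =
      ∑ σ ∈ support G n o k, ({ω | run G n o ω k = σ} : Set _).indicator (fun ω => g (step G n ω σ)) ω := by
    intro ω
    rw [Finset.sum_eq_single (run G n o ω k)]
    · simp [run_succ]
    · intro σ _ hne
      rw [Set.indicator_of_notMem]
      exact fun h => hne h.symm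
    · intro h; exact absurd (run_mem_support o ω k) h
  simp_rw [hpt]
  have hint : ∀ σ ∈ support G n o k,
      Integrable (({ω | run G n o ω k = σ} : Set _).indicator fun ω => g (step G n ω σ)) P := by
    intro σ _
    refine Integrable.indicator ?_ (measurableSet_run_eq o k σ)
    by_cases h : Halted G n σ
    · simp only [step_of_halted h]; exact integrable_const _
    · simp only [step_of_not_halted h]
      have : (fun ω : Set (Sym2 V) => g (extend G n σ h (decide (nextEdge G n σ h ∈ ω)))) =
          fun ω => ({ω : Set (Sym2 V) | nextEdge G n σ h ∈ ω}).indicator (fun _ => g (extend G n σ h true)) ω +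
            ({ω : Set (Sym2 V) | nextEdge G n σ h ∈ ω}ᶜ).indicator (fun _ => g (extend G n σ h false)) ω := by
        funext ω
        by_cases he : nextEdge G n σ h ∈ ω
        · simp [he]
        · simp [he]
      rw [this]
      exact ((integrable_const _).indicator (measurableSet_mem _)).add
        ((integrable_const _).indicator (measurableSet_mem _).compl)
  rw [integral_finsetSum _ hint]
  refine Finset.sum_congr rfl fun σ hσ => ?_
  by_cases h : Halted G n σ
  · simp only [step_of_halted h, h, dite_true]
    rw [integral_indicator_const _ (measurableSet_run_eq o k σ), smul_eq_mul, mul_comm]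
  · simp only [step_of_not_halted h, h, dite_false]
    -- split the atom according to the answer
    have hm : ∀ b : Bool, MeasurableSet ({ω | run G n o ω k = σ} ∩
        {ω : Set (Sym2 V) | (nextEdge G n σ h ∈ ω ↔ b = true)}) := by
      intro b
      refine (measurableSet_run_eq o k σ).inter ?_
      cases b
      · have : {ω : Set (Sym2 V) | (nextEdge G n σ h ∈ ω ↔ false = true)} = {ω | nextEdge G n σ h ∉ ω} := by
          ext ω; simp
        rw [this]; exact measurableSet_notMem _
      · have : {ω : Set (Sym2 V) | (nextEdge G n σ h ∈ ω ↔ true = true)} = {ω | nextEdge G n σ h ∈ ω} := by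
          ext ω; simp
        rw [this]; exact measurableSet_mem _
    have hsplit : (({ω | run G n o ω k = σ} : Set _).indicator fun ω : Set (Sym2 V) =>
        g (extend G n σ h (decide (nextEdge G n σ h ∈ ω)))) = fun ω =>
        ({ω | run G n o ω k = σ} ∩ {ω : Set (Sym2 V) | (nextEdge G n σ h ∈ ω ↔ true = true)}).indicator
            (fun _ => g (extend G n σ h true)) ω +
          ({ω | run G n o ω k = σ} ∩ {ω : Set (Sym2 V) | (nextEdge G n σ h ∈ ω ↔ false = true)}).indicator
            (fun _ => g (extend G n σ h false)) ω := by
      funext ω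
      by_cases hr : run G n o ω k = σ
      · by_cases he : nextEdge G n σ h ∈ ω
        · simp [hr, he]
        · simp [hr, he]
      · simp [hr]
    rw [hsplit, integral_add ((integrable_const _).indicator (hm true)) ((integrable_const _).indicator (hm false)),
      integral_indicator_const _ (hm true), integral_indicator_const _ (hm false),
      real_run_eq_inter_answer p hσ h true, real_run_eq_inter_answer p hσ h false]
    simp only [smul_eq_mul, ite_true]
    simp
    ring


/-! ### The score process `Z = (1 - p)·#open - p·#closed` and its second moment -/

/-- The score of a state: `(1 - p)·(number of open answers) - p·(number of closed answers)`.
[cite: Hutchcroft2020Locality, §3, proof of Thm. 1.6] -/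
def score (p : unitInterval) (σ : State V) : ℝ := (1 - p) * numOpen σ - p * numClosed σ

omit [DecidableEq V] [G.LocallyFinite] in
/-- The initial score is `0`. [folklore] -/
theorem score_init (p : unitInterval) (o : V) : score p (init o) = 0 := by
  simp [score, init, numOpen, numClosed]

/-- The score changes by `1 - p` on an open answer and by `-p` on a closed one (martingale increments). [folklore] -/
theorem score_extend (p : unitInterval) {σ : State V} (h : ¬ Halted G n σ) (b : Bool) :
    score p (extend G n σ h b) = score p σ + (if b then (1 - p : ℝ) else -p) := by
  simp only [score, numOpen_extend h b, numClosed_extend h b]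
  cases b <;> simp <;> ring

open Classical in
/-- **Orthogonality of the increments**: `E[Z_{k+1}^2] = E[Z_k^2] + p(1-p)·P(not halted at k)`.
[cite: Hutchcroft2020Locality, §3, proof of Thm. 1.6] -/
theorem integral_score_sq_succ (p : unitInterval) (o : V) (k : ℕ) :
    ∫ ω, (score p (run G n o ω (k + 1))) ^ 2 ∂(bondPercolation G p) =
      ∫ ω, (score p (run G n o ω k)) ^ 2 ∂(bondPercolation G p) +
        (p : ℝ) * (1 - p) * (bondPercolation G p).real {ω | ¬ Halted G n (run G n o ω k)} := by
  rw [integral_comp_run_succ p o k (fun σ => (score p σ) ^ 2),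
    integral_comp_run p o k (fun σ => (score p σ) ^ 2),
    real_setOf_run p o k (fun σ => ¬ Halted G n σ), Finset.mul_sum, Finset.sum_filter,
    ← Finset.sum_add_distrib]
  refine Finset.sum_congr rfl fun σ _ => ?_
  by_cases h : Halted G n σ
  · simp [h]
  · simp only [h, dite_false, score_extend, ite_true]
    simp
    ring

/-- `E[Z_N^2] = p(1-p) Σ_{k<N} P(not halted at k)`.
[cite: Hutchcroft2020Locality, §3, proof of Thm. 1.6] -/
theorem integral_score_sq_eq (p : unitInterval) (o : V) :
    ∀ N, ∫ ω, (score p (run G n o ω N)) ^ 2 ∂(bondPercolation G p) =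
      (p : ℝ) * (1 - p) * ∑ k ∈ Finset.range N, (bondPercolation G p).real {ω | ¬ Halted G n (run G n o ω k)}
  | 0 => by simp [score_init]
  | N + 1 => by
    classical
    rw [integral_score_sq_succ, integral_score_sq_eq p o N, Finset.sum_range_succ]
    ring

/-- **Second moment of the score**: `E[Z_N^2] ≤ p(1-p) N`.
[cite: Hutchcroft2020Locality, §3, proof of Thm. 1.6] -/
theorem integral_score_sq_le (p : unitInterval) (o : V) (N : ℕ) :
    ∫ ω, (score p (run G n o ω N)) ^ 2 ∂(bondPercolation G p) ≤ (p : ℝ) * (1 - p) * N := by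
  classical
  rw [integral_score_sq_eq p o N]
  have hp0 : 0 ≤ (p : ℝ) := p.2.1
  have hp1 : (p : ℝ) ≤ 1 := p.2.2
  refine mul_le_mul_of_nonneg_left ?_ (mul_nonneg hp0 (by linarith))
  calc ∑ k ∈ Finset.range N, (bondPercolation G p).real {ω | ¬ Halted G n (run G n o ω k)}
      ≤ ∑ _k ∈ Finset.range N, (1 : ℝ) := Finset.sum_le_sum fun k _ => measureReal_le_one
    _ = N := by simp

/-! ### What the exploration reveals of a small finite cluster -/

open LatticeModels in
/-- The active set has at most `k + 1` vertices after `k` steps. [folklore] -/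
theorem card_A_run_le (o : V) (ω : Set (Sym2 V)) : ∀ k, (run G n o ω k).A.card ≤ k + 1
  | 0 => by simp [init]
  | k + 1 => by
    rw [run_succ]
    by_cases h : Halted G n (run G n o ω k)
    · rw [step_of_halted h]; exact (card_A_run_le o ω k).trans (Nat.le_succ _)
    · rw [step_of_not_halted h]
      exact (card_extend_le h _).trans (Nat.succ_le_succ (card_A_run_le o ω k))

open LatticeModels in
/-- The queried edges touch the open cluster of the root. [folklore] -/
theorem queried_run_subset (o : V) {ω : Set (Sym2 V)} (k : ℕ) {K : Finset V}
    (hK : openCluster ω o ⊆ ↑K) : queried (run G n o ω k) ⊆ edgesTouching G K := by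
  intro e he
  obtain ⟨hE, u, hu, hue⟩ := (inv_run o ω k).queried_spec e he
  rw [mem_edgesTouching_iff]
  exact ⟨hE, u, Finset.mem_coe.1 (hK (coe_A_subset_openCluster o ω k (Finset.mem_coe.2 hu))), hue⟩

open LatticeModels in
/-- Hence at most `|E(K)|` queries are ever made, `K ⊇ C(o)`. [folklore] -/
theorem length_hist_run_le_card (o : V) {ω : Set (Sym2 V)} (k : ℕ) {K : Finset V}
    (hK : openCluster ω o ⊆ ↑K) : (run G n o ω k).hist.length ≤ (edgesTouching G K).card := by
  rw [← card_queried_run]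
  exact Finset.card_le_card (queried_run_subset o k hK)

open LatticeModels in
/-- If `C(o) ⊆ K` with `|E(K)| ≤ N` and the vertex cap is not reached (`N + 2 ≤ n`), then after
`N` steps every edge at the active set has been queried. [folklore] -/
theorem boundary_run_eq_empty (o : V) {ω : Set (Sym2 V)} {N : ℕ} {K : Finset V}
    (hK : openCluster ω o ⊆ ↑K) (hN : (edgesTouching G K).card ≤ N) (hn : N + 2 ≤ n) :
    boundary G (run G n o ω N) = ∅ := by
  by_contra hB
  have hnot : ∀ k, k ≤ N → ¬ Halted G n (run G n o ω k) := by
    intro k hk hH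
    rcases hH with hA | hb
    · have := card_A_run_le (G := G) (n := n) o ω k
      omega
    · have heq := run_eq_of_halted (G := G) (n := n) (o := o) (ω := ω) (k := k) (Or.inr hb) N hk
      rw [heq] at hB
      exact hB hb
  have hlen := length_hist_run_of_forall_not_halted (G := G) (n := n) o ω (N + 1)
    fun k hk => hnot k (by omega)
  have hle := length_hist_run_le_card (G := G) (n := n) o (N + 1) hK
  omega

open LatticeModels in
/-- Under the same hypotheses the active set after `N` steps is the whole cluster (`ω ⊆ E(G)`).
[folklore] -/
theorem coe_A_run_eq (o : V) {ω : Set (Sym2 V)} (hω : ω ⊆ G.edgeSet) {N : ℕ} {K : Finset V}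
    (hK : openCluster ω o ⊆ ↑K) (hN : (edgesTouching G K).card ≤ N) (hn : N + 2 ≤ n) :
    (↑(run G n o ω N).A : Set V) = openCluster ω o :=
  Set.Subset.antisymm (coe_A_subset_openCluster o ω N)
    (openCluster_subset_of_boundary_eq_empty o hω N (boundary_run_eq_empty o hK hN hn))

open LatticeModels in
/-- ... and the queried edges are exactly the edges touching the cluster. [folklore] -/
theorem queried_run_eq (o : V) {ω : Set (Sym2 V)} (hω : ω ⊆ G.edgeSet) {N : ℕ} {K : Finset V}
    (hK : (↑K : Set V) = openCluster ω o) (hN : (edgesTouching G K).card ≤ N) (hn : N + 2 ≤ n) :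
    queried (run G n o ω N) = edgesTouching G K := by
  refine Finset.Subset.antisymm (queried_run_subset o N hK.symm.subset) fun e he => ?_
  by_contra hq
  rw [mem_edgesTouching_iff] at he
  obtain ⟨hE, x, hx, hxe⟩ := he
  have hB := boundary_run_eq_empty (G := G) (n := n) o hK.symm.subset hN hn
  have hxA : x ∈ (run G n o ω N).A := by
    rw [← Finset.mem_coe, coe_A_run_eq o hω hK.symm.subset hN hn, ← hK]
    exact Finset.mem_coe.2 hx
  obtain ⟨y, rfl⟩ := hxe
  have hadj : G.Adj x y := by rwa [SimpleGraph.mem_edgeSet] at hE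
  have : s(x, y) ∈ boundary G (run G n o ω N) := mem_boundary_iff.2 ⟨⟨x, hxA, y, hadj, rfl⟩, hq⟩
  rw [hB] at this
  exact absurd this (Finset.notMem_empty _)

omit [G.LocallyFinite] in
/-- In a state satisfying the invariant, a queried edge is recorded `open` iff it is open.
[folklore] -/
theorem mem_true_iff_mem {o : V} {ω : Set (Sym2 V)} {σ : State V} (hI : Inv G n o ω σ) {e : Sym2 V}
    (he : e ∈ queried σ) : (e, true) ∈ σ.hist ↔ e ∈ ω := by
  obtain ⟨b, hb⟩ := mem_queried_iff.1 he
  rw [mem_true_iff_of_nodup hI.nodup hb, ← hI.answers _ hb]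

open LatticeModels in
open Classical in
/-- Under the hypotheses of `queried_run_eq`, the number of open answers after `N` steps is the
number of open edges touching the cluster. [folklore] -/
theorem numOpen_run_eq (o : V) {ω : Set (Sym2 V)} (hω : ω ⊆ G.edgeSet) {N : ℕ} {K : Finset V}
    (hK : (↑K : Set V) = openCluster ω o) (hN : (edgesTouching G K).card ≤ N) (hn : N + 2 ≤ n) :
    numOpen (run G n o ω N) = ((edgesTouching G K).filter fun e => e ∈ ω).card := by
  have hI := inv_run (G := G) (n := n) o ω N
  rw [numOpen, ← card_filter_true_eq hI.nodup, ← queried_run_eq o hω hK hN hn]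
  change ((queried (run G n o ω N)).filter fun e => (e, true) ∈ (run G n o ω N).hist).card = _
  rw [Finset.filter_congr fun e he => mem_true_iff_mem hI he]

open LatticeModels in
open Classical in
/-- ... and the number of closed answers is the number of closed edges touching the cluster.
[folklore] -/
theorem numClosed_run_eq (o : V) {ω : Set (Sym2 V)} (hω : ω ⊆ G.edgeSet) {N : ℕ} {K : Finset V}
    (hK : (↑K : Set V) = openCluster ω o) (hN : (edgesTouching G K).card ≤ N) (hn : N + 2 ≤ n) :
    numClosed (run G n o ω N) = ((edgesTouching G K).filter fun e => e ∉ ω).card := by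
  have hI := inv_run (G := G) (n := n) o ω N
  rw [numClosed, ← card_filter_not_true_eq hI.nodup, ← queried_run_eq o hω hK hN hn]
  change ((queried (run G n o ω N)).filter fun e => (e, true) ∉ (run G n o ω N).hist).card = _
  rw [Finset.filter_congr fun e he => not_congr (mem_true_iff_mem hI he)]

open LatticeModels in
open Classical in
/-- **The terminal score is `-h_p(C(o))`**: if the cluster of `o` is finite with vertex set `K`,
`|E(K)| ≤ N` and `N + 2 ≤ n`, then after `N` steps
`Z_N = (1 - p)·#{open edges touching K} - p·#{closed edges touching K}`.
[cite: Hutchcroft2020Locality, §3, proof of Thm. 1.6] -/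
theorem score_run_eq (p : unitInterval) (o : V) {ω : Set (Sym2 V)} (hω : ω ⊆ G.edgeSet) {N : ℕ}
    {K : Finset V} (hK : (↑K : Set V) = openCluster ω o) (hN : (edgesTouching G K).card ≤ N)
    (hn : N + 2 ≤ n) :
    score p (run G n o ω N) =
      (1 - p : ℝ) * ((edgesTouching G K).filter fun e => e ∈ ω).card -
        (p : ℝ) * ((edgesTouching G K).filter fun e => e ∉ ω).card := by
  rw [score, numOpen_run_eq o hω hK hN hn, numClosed_run_eq o hω hK hN hn]

end ClusterExploration


namespace TwoGhost

/-! ## Part B. Mass transport on `ℤ^d`; summation lemmas in `ℝ≥0∞` -/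


section LatticeMTP

open Literature.Probability.LatticeModels

variable {d : ℕ}

/-! ### Mass transport on `ℤ^d` (edge-to-vertex form)

An edge of `ℤ^d` is labelled by `(v, i) : Site d × Fin d` (the edge `{v, v + eᵢ}`); the labels of
the `2d` edges at the vertex `x` are `(x, i)` and `(x - eᵢ, i)`. -/

/-- Translation of edge labels by `u`. [folklore] -/
def labelShift (u : Site d) : (Site d × Fin d) ≃ (Site d × Fin d) where
  toFun ℓ := (ℓ.1 + u, ℓ.2)
  invFun ℓ := (ℓ.1 - u, ℓ.2)
  left_inv ℓ := by simp
  right_inv ℓ := by simp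

/-- `labelShift u (v, i) = (v + u, i)`. [folklore] -/
@[simp] theorem labelShift_apply (u : Site d) (ℓ : Site d × Fin d) : labelShift u ℓ = (ℓ.1 + u, ℓ.2) := rfl

/-- **The mass-transport principle on `ℤ^d`** (Hutchcroft 2020, §2, eq. (2.1)/(2.2), for the
transitive group of translations of `ℤ^d`, which is unimodular): for a translation-invariant
transport `Γ` from edges to vertices, the mass sent out by the `2d` edges at `x` equals twice the
mass received by `x` (each edge having two endpoints). Edges are labelled by
`(v, i) ↦ {v, v + eᵢ}`; the edges at `x` are `(x, i)` and `(x - eᵢ, i)`.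
[cite: Hutchcroft2020Locality, §2, (2.1)–(2.2)] -/
theorem edge_vertex_mass_transport (Γ : Site d × Fin d → Site d → ℝ≥0∞)
    (hΓ : ∀ (u : Site d) (ℓ : Site d × Fin d) (v : Site d), Γ (labelShift u ℓ) (v + u) = Γ ℓ v)
    (x : Site d) :
    ∑ i : Fin d, ∑' v, (Γ (x, i) v + Γ (x - Pi.single i 1, i) v) = 2 * ∑' ℓ, Γ ℓ x := by
  have h1 : ∀ (i : Fin d) (v : Site d), Γ (x, i) v = Γ (x + x - v, i) x := by
    intro i v
    have := hΓ (x - v) (x, i) v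
    simp only [labelShift_apply, add_sub_cancel] at this
    rw [← this, add_sub_assoc]
  have h2 : ∀ (i : Fin d) (v : Site d), Γ (x - Pi.single i 1, i) v = Γ (x + x - Pi.single i 1 - v, i) x := by
    intro i v
    have := hΓ (x - v) (x - Pi.single i 1, i) v
    simp only [labelShift_apply, add_sub_cancel] at this
    rw [← this]
    congr 2
    abel
  have hi : ∀ i : Fin d, ∑' v, (Γ (x, i) v + Γ (x - Pi.single i 1, i) v) = 2 * ∑' v, Γ (v, i) x := by
    intro i
    rw [ENNReal.tsum_add, two_mul]
    congr 1
    · simp_rw [h1 i]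
      simpa only [Equiv.subLeft_apply] using Equiv.tsum_eq (Equiv.subLeft (x + x)) (fun v => Γ (v, i) x)
    · simp_rw [h2 i]
      simpa only [Equiv.subLeft_apply] using
        Equiv.tsum_eq (Equiv.subLeft (x + x - Pi.single i 1)) (fun v => Γ (v, i) x)
  simp_rw [hi, ← Finset.mul_sum]
  congr 1
  rw [ENNReal.tsum_prod', ENNReal.tsum_comm]
  exact (tsum_fintype (L := SummationFilter.unconditional _) _).symm

end LatticeMTP

section Analysis

/-! ### Telescoping and summation by parts in `ℝ≥0∞` -/

/-- Telescoping: for an antitone sequence of finite terms tending to `0`,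
`Σ_k (a (t+k) - a (t+k+1)) = a t`. [folklore] -/
theorem tsum_sub_succ_of_antitone {a : ℕ → ℝ≥0∞} (ha : Antitone a)
    (h0 : Tendsto a atTop (𝓝 0)) (t : ℕ) :
    ∑' k, (a (t + k) - a (t + k + 1)) = a t := by
  rw [ENNReal.tsum_eq_iSup_nat]
  have hpart : ∀ K, ∑ k ∈ Finset.range K, (a (t + k) - a (t + k + 1)) = a t - a (t + K) := by
    intro K
    induction K with
    | zero => simp
    | succ K ih =>
      rw [Finset.sum_range_succ, ih, show t + (K + 1) = t + K + 1 from rfl,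
        tsub_add_tsub_cancel (ha (Nat.le_add_right t K)) (ha (Nat.le_succ _))]
  simp_rw [hpart]
  rw [← ENNReal.sub_iInf]
  have ht : Tendsto (fun K : ℕ => t + K) atTop atTop :=
    tendsto_atTop_atTop.2 fun b => ⟨b, fun K hK => le_add_left hK⟩
  have : ⨅ K, a (t + K) = 0 :=
    iInf_eq_of_tendsto (fun i j hij => ha (Nat.add_le_add_left hij t)) (h0.comp ht)
  rw [this, tsub_zero]

/-- Reindexing a sum over `{N | t ≤ N}`. [folklore] -/
theorem tsum_ite_le_eq (f : ℕ → ℝ≥0∞) (t : ℕ) :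
    ∑' N, (if t ≤ N then f N else 0) = ∑' k, f (t + k) := by
  set g : ℕ → ℝ≥0∞ := fun N => if t ≤ N then f N else 0 with hg
  have h1 : (fun k => g (k + t)) = fun k => f (t + k) := by
    funext k; simp [hg, add_comm]
  have h2 : HasSum (fun k => g (k + t)) (∑' k, f (t + k)) := by
    rw [h1]; exact ENNReal.summable.hasSum
  have h3 := h2.sum_range_add
  have h4 : ∑ i ∈ Finset.range t, g i = 0 :=
    Finset.sum_eq_zero fun i hi => by
      rw [Finset.mem_range] at hi
      simp [hg, Nat.not_le.2 hi]
  rw [h4, zero_add] at h3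
  exact h3.tsum_eq

/-- `Σ_N N·δ_N = Σ_t Σ_k δ_{t+1+k}` (Tonelli on `{(t, N) | t < N}`). [folklore] -/
theorem tsum_natCast_mul_eq (δ : ℕ → ℝ≥0∞) :
    ∑' N : ℕ, (N : ℝ≥0∞) * δ N = ∑' t, ∑' k, δ (t + 1 + k) := by
  have h1 : ∀ N : ℕ, (N : ℝ≥0∞) * δ N = ∑' t : ℕ, if t + 1 ≤ N then δ N else 0 := by
    intro N
    rw [tsum_eq_sum (s := Finset.range N) (L := SummationFilter.unconditional _)]
    · rw [Finset.sum_congr rfl (g := fun _ => δ N), Finset.sum_const, Finset.card_range, nsmul_eq_mul]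
      intro t ht
      rw [Finset.mem_range] at ht
      exact if_pos (by omega)
    · intro t ht
      rw [Finset.mem_range] at ht
      exact if_neg (by omega)
  simp_rw [h1]
  rw [ENNReal.tsum_comm]
  exact tsum_congr fun t => tsum_ite_le_eq δ (t + 1)

/-- **Summation by parts** (the form used for Hutchcroft 2020, proof of Thm. 1.6, display
(3.7)ff, with Doob's inequality replaced by the plain second-moment bound): if
`∫ 1(τ ≤ N)·X ≤ C·N` for every `N`, then for an antitone weight `a → 0`,
`∫ a(τ)·X ≤ C · Σ_{t ≥ 1} a(t)`. [cite: Hutchcroft2020Locality, §3, proof of Thm. 1.6] -/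
theorem lintegral_weight_le {Ω : Type*} [MeasurableSpace Ω] (μ : Measure Ω) {a : ℕ → ℝ≥0∞}
    (ha : Antitone a) (h0 : Tendsto a atTop (𝓝 0)) {X : Ω → ℝ≥0∞} (hX : Measurable X)
    {τ : Ω → ℕ} (hτ : Measurable τ) {C : ℝ≥0∞}
    (hC : ∀ N : ℕ, ∫⁻ ω, {ω | τ ω ≤ N}.indicator X ω ∂μ ≤ C * N) :
    ∫⁻ ω, a (τ ω) * X ω ∂μ ≤ C * ∑' t, a (t + 1) := by
  classical
  set δ : ℕ → ℝ≥0∞ := fun N => a N - a (N + 1) with hδ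
  -- `a (τ ω) = Σ_N 1(τ ω ≤ N) δ_N`
  have hrep : ∀ ω, a (τ ω) * X ω = ∑' N, {ω | τ ω ≤ N}.indicator (fun ω => δ N * X ω) ω := by
    intro ω
    have h := tsum_sub_succ_of_antitone ha h0 (τ ω)
    rw [← h, ← tsum_ite_le_eq (fun N => a N - a (N + 1)) (τ ω), ← ENNReal.tsum_mul_right]
    refine tsum_congr fun N => ?_
    by_cases hN : τ ω ≤ N
    · rw [if_pos hN, Set.indicator_of_mem (show ω ∈ {ω | τ ω ≤ N} from hN)]
    · rw [if_neg hN, Set.indicator_of_notMem (show ω ∉ {ω | τ ω ≤ N} from hN), zero_mul]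
  have hmeas : ∀ N, MeasurableSet {ω | τ ω ≤ N} := fun N => hτ measurableSet_Iic
  simp_rw [hrep]
  rw [lintegral_tsum fun N => ((hX.const_mul (δ N)).indicator (hmeas N)).aemeasurable]
  calc ∑' N, ∫⁻ ω, {ω | τ ω ≤ N}.indicator (fun ω => δ N * X ω) ω ∂μ
      = ∑' N, δ N * ∫⁻ ω, {ω | τ ω ≤ N}.indicator X ω ∂μ := by
        refine tsum_congr fun N => ?_
        rw [← lintegral_const_mul _ (hX.indicator (hmeas N))]
        refine lintegral_congr fun ω => ?_
        by_cases hN : ω ∈ {ω | τ ω ≤ N}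
        · simp [Set.indicator_of_mem hN]
        · simp [Set.indicator_of_notMem hN]
    _ ≤ ∑' N, δ N * (C * N) := ENNReal.tsum_le_tsum fun N => mul_le_mul_right (hC N) _
    _ = C * ∑' N : ℕ, (N : ℝ≥0∞) * δ N := by
        rw [← ENNReal.tsum_mul_left]
        exact tsum_congr fun N => by
          rw [← mul_assoc, mul_comm (δ N) C, mul_assoc, mul_comm (δ N)]
    _ = C * ∑' t, a (t + 1) := by
        rw [tsum_natCast_mul_eq]
        congr 1
        refine tsum_congr fun t => ?_
        have := tsum_sub_succ_of_antitone ha h0 (t + 1)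
        simpa [hδ, add_assoc] using this


/-- Splitting a sum over `ℕ` at `n`. [folklore] -/
theorem tsum_eq_sum_range_add_tsum (f : ℕ → ℝ≥0∞) (n : ℕ) :
    ∑' t, f t = ∑ t ∈ Finset.range n, f t + ∑' k, f (k + n) :=
  ((ENNReal.summable.hasSum (f := fun k => f (k + n))).sum_range_add).tsum_eq

/-- `1/(m+1)^2 ≤ 1/m - 1/(m+1)` in `ℝ≥0∞`, for `m ≥ 1`. [folklore] -/
theorem inv_succ_sq_le_sub {m : ℕ} (hm : 1 ≤ m) :
    ((m + 1 : ℕ) : ℝ≥0∞)⁻¹ ^ 2 ≤ (m : ℝ≥0∞)⁻¹ - ((m + 1 : ℕ) : ℝ≥0∞)⁻¹ := by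
  have hm0 : (0 : ℝ) < m := by exact_mod_cast hm
  have hm1 : (0 : ℝ) < (m + 1 : ℕ) := by positivity
  have e1 : ((m : ℕ) : ℝ≥0∞)⁻¹ = ENNReal.ofReal ((m : ℝ)⁻¹) := by
    rw [ENNReal.ofReal_inv_of_pos hm0, ENNReal.ofReal_natCast]
  have e2 : ((m + 1 : ℕ) : ℝ≥0∞)⁻¹ = ENNReal.ofReal (((m + 1 : ℕ) : ℝ)⁻¹) := by
    rw [ENNReal.ofReal_inv_of_pos hm1, ENNReal.ofReal_natCast]
  rw [e1, e2, ← ENNReal.ofReal_pow (inv_nonneg.2 hm1.le), ← ENNReal.ofReal_sub _ (inv_nonneg.2 hm1.le)]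
  refine ENNReal.ofReal_le_ofReal ?_
  rw [inv_pow, inv_sub_inv hm0.ne' hm1.ne']
  push_cast
  rw [show ((m : ℝ) + 1 - m) = 1 by ring, one_div]
  exact inv_anti₀ (by positivity) (by nlinarith)

/-- The weight sum: `Σ_{t ≥ 1} min(1/n², 1/t²) ≤ 2/n`. [folklore] -/
theorem tsum_min_inv_sq_le {n : ℕ} (hn : 1 ≤ n) :
    ∑' t : ℕ, min ((n : ℝ≥0∞)⁻¹ ^ 2) (((t + 1 : ℕ) : ℝ≥0∞)⁻¹ ^ 2) ≤ 2 * (n : ℝ≥0∞)⁻¹ := by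
  rw [tsum_eq_sum_range_add_tsum _ n, two_mul]
  have hn0 : (n : ℝ≥0∞) ≠ 0 := by exact_mod_cast (show n ≠ 0 by omega)
  have hnT : (n : ℝ≥0∞) ≠ ∞ := ENNReal.natCast_ne_top n
  refine add_le_add ?_ ?_
  · calc ∑ t ∈ Finset.range n, min ((n : ℝ≥0∞)⁻¹ ^ 2) (((t + 1 : ℕ) : ℝ≥0∞)⁻¹ ^ 2)
        ≤ ∑ _t ∈ Finset.range n, (n : ℝ≥0∞)⁻¹ ^ 2 := Finset.sum_le_sum fun t _ => min_le_left _ _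
      _ = (n : ℝ≥0∞)⁻¹ := by
        rw [Finset.sum_const, Finset.card_range, nsmul_eq_mul, sq, ← mul_assoc,
          ENNReal.mul_inv_cancel hn0 hnT, one_mul]
  · have htel := tsum_sub_succ_of_antitone (a := fun m : ℕ => (m : ℝ≥0∞)⁻¹)
      (fun i j hij => ENNReal.inv_le_inv.2 (by exact_mod_cast hij)) ENNReal.tendsto_inv_nat_nhds_zero n
    rw [← htel]
    refine ENNReal.tsum_le_tsum fun k => (min_le_right _ _).trans ?_
    have := inv_succ_sq_le_sub (m := n + k) (by omega)
    rw [show k + n + 1 = n + k + 1 by omega]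
    exact this

/-- **Cauchy–Schwarz** on a probability space: `(∫ f)² ≤ ∫ f²`. [folklore] -/
theorem lintegral_sq_le {Ω : Type*} [MeasurableSpace Ω] (μ : Measure Ω) [IsProbabilityMeasure μ]
    {f : Ω → ℝ≥0∞} (hf : AEMeasurable f μ) :
    (∫⁻ ω, f ω ∂μ) ^ 2 ≤ ∫⁻ ω, f ω ^ 2 ∂μ := by
  have h := ENNReal.lintegral_mul_le_Lp_mul_Lq μ Real.HolderConjugate.two_two hf
    (g := fun _ => 1) aemeasurable_const
  simp only [Pi.mul_apply, mul_one, ENNReal.one_rpow, lintegral_const, measure_univ,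
    one_div] at h
  have h2 : (∫⁻ ω, f ω ∂μ) ≤ (∫⁻ ω, f ω ^ (2 : ℝ) ∂μ) ^ (2 : ℝ)⁻¹ := by simpa using h
  have h3 := ENNReal.rpow_le_rpow h2 (z := 2) (by norm_num)
  rw [← ENNReal.rpow_mul, inv_mul_cancel₀ (by norm_num), ENNReal.rpow_one] at h3
  have e : ∀ x : ℝ≥0∞, x ^ (2 : ℝ) = x ^ 2 := fun x => by
    rw [show (2 : ℝ) = (2 : ℕ) by norm_num, ENNReal.rpow_natCast]
  simpa [e] using h3

end Analysis

/-! ## Part C. Clusters, flips, cluster data, edge labels and translations -/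


/-! ### Clusters, the edges they touch, and flipping one edge (general graph) -/

section General

variable {V : Type*} (G : SimpleGraph V)

/-- `E(K)`: the edges of `G` touching the vertex set `K` (Hutchcroft 2020, §1: "`E(K_v)` the set
of edges that touch `K_v`, i.e., have at least one endpoint in `K_v`").
[cite: Hutchcroft2020Locality, §1 (E(K_v)) and §3 (E(H))] -/
def touch (K : Set V) : Set (Sym2 V) := {e ∈ G.edgeSet | ∃ v ∈ e, v ∈ K}

variable {G}

/-- Membership in `E(K)`. [folklore] -/
theorem mem_touch {K : Set V} {e : Sym2 V} : e ∈ touch G K ↔ e ∈ G.edgeSet ∧ ∃ v ∈ e, v ∈ K :=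
  Iff.rfl

/-- `E(·)` is monotone. [folklore] -/
theorem touch_mono {K K' : Set V} (h : K ⊆ K') : touch G K ⊆ touch G K' :=
  fun _ ⟨he, v, hv, hvK⟩ => ⟨he, v, hv, h hvK⟩

/-- `E(K ∪ K') = E(K) ∪ E(K')`. [folklore] -/
theorem touch_union (K K' : Set V) : touch G (K ∪ K') = touch G K ∪ touch G K' := by
  ext e
  simp only [touch, Set.mem_setOf_eq, Set.mem_union]
  constructor
  · rintro ⟨he, v, hv, h | h⟩
    · exact Or.inl ⟨he, v, hv, h⟩
    · exact Or.inr ⟨he, v, hv, h⟩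
  · rintro (⟨he, v, hv, h⟩ | ⟨he, v, hv, h⟩)
    · exact ⟨he, v, hv, Or.inl h⟩
    · exact ⟨he, v, hv, Or.inr h⟩

/-- `E(K) ⊆ E(G)`. [folklore] -/
theorem touch_subset_edgeSet (K : Set V) : touch G K ⊆ G.edgeSet := fun _ h => h.1

/-- For a finite vertex set, `E(K)` is the tree's `edgesTouching`. [folklore] -/
theorem touch_coe_eq [DecidableEq V] [G.LocallyFinite] (K : Finset V) :
    touch G (↑K : Set V) = ↑(LatticeModels.edgesTouching G K) := by
  ext e
  rw [mem_touch, Finset.mem_coe, LatticeModels.mem_edgesTouching_iff]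
  simp only [Finset.mem_coe]
  exact ⟨fun ⟨he, v, hv, hvK⟩ => ⟨he, v, hvK, hv⟩, fun ⟨he, v, hvK, hv⟩ => ⟨he, v, hv, hvK⟩⟩

/-- A finite vertex set of a locally finite graph touches finitely many edges. [folklore] -/
theorem touch_finite [G.LocallyFinite] {K : Set V} (hK : K.Finite) : (touch G K).Finite := by
  classical
  rw [← hK.coe_toFinset, touch_coe_eq]
  exact Finset.finite_toSet _

/-! #### Clusters -/

/-- Open clusters are equivalence classes: `b ∈ C(a) → C(b) = C(a)`. [folklore] -/
theorem openCluster_eq_of_mem {ω : BondConfig V} {a b : V} (h : b ∈ openCluster ω a) :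
    openCluster ω b = openCluster ω a := by
  ext y
  exact ⟨fun hy => SimpleGraph.Reachable.trans h hy, fun hy => SimpleGraph.Reachable.trans h.symm hy⟩

/-- `b ∈ C(a) ↔ a ∈ C(b)`. [folklore] -/
theorem mem_openCluster_comm {ω : BondConfig V} {a b : V} : b ∈ openCluster ω a ↔ a ∈ openCluster ω b :=
  ⟨fun h => SimpleGraph.Reachable.symm h, fun h => SimpleGraph.Reachable.symm h⟩

/-- Distinct open clusters are disjoint. [folklore] -/
theorem disjoint_openCluster_of_not_mem {ω : BondConfig V} {a b : V} (h : b ∉ openCluster ω a) :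
    Disjoint (openCluster ω a) (openCluster ω b) := by
  rw [Set.disjoint_left]
  intro y hya hyb
  exact h (SimpleGraph.Reachable.trans hya (SimpleGraph.Reachable.symm hyb))

/-- The endpoints of an open edge have the same cluster. [folklore] -/
theorem openCluster_eq_of_mk_mem {ω : BondConfig V} {a b : V} (hab : a ≠ b) (h : s(a, b) ∈ ω) :
    openCluster ω b = openCluster ω a :=
  openCluster_eq_of_mem (SimpleGraph.Adj.reachable ((openGraph_adj ω a b).2 ⟨h, hab⟩))

/-- An open path from `a` stays inside any vertex set containing `a` and closed under open edges.
[folklore] -/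
theorem openCluster_subset_of_closed {ω : BondConfig V} {a : V} {U : Set V} (ha : a ∈ U)
    (hU : ∀ x ∈ U, ∀ y, (openGraph ω).Adj x y → y ∈ U) : openCluster ω a ⊆ U := by
  have key : ∀ {x v : V} (p : (openGraph ω).Walk x v), x ∈ U → v ∈ U := by
    intro x v p
    induction p with
    | nil => exact id
    | cons hadj _ ih => exact fun hx => ih (hU _ hx _ hadj)
  intro v hv
  obtain ⟨p⟩ := (hv : (openGraph ω).Reachable a v)
  exact key p ha

/-- **Flipping the edge `{a, b}` does not change `C(a) ∪ C(b)`** (the union of the clusters at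
its endpoints): the fact behind "the event `F_e ∩ G_e` is independent of the value of `ω(e)`"
(Hutchcroft 2020, proof of Lemma 3.1). [cite: Hutchcroft2020Locality, §3, proof of Lemma 3.1] -/
theorem union_openCluster_insert_eq (ω : BondConfig V) (a b : V) :
    openCluster (insert s(a, b) ω) a ∪ openCluster (insert s(a, b) ω) b =
      openCluster (ω \ {s(a, b)}) a ∪ openCluster (ω \ {s(a, b)}) b := by
  set ω' := ω \ {s(a, b)} with hω'
  set U := openCluster ω' a ∪ openCluster ω' b with hUdef
  have hmono : ω' ⊆ insert s(a, b) ω := fun e he => Set.mem_insert_of_mem _ he.1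
  refine Set.Subset.antisymm ?_ (Set.union_subset_union (openCluster_mono hmono a) (openCluster_mono hmono b))
  -- `U` contains `a, b` and is closed under the open edges of `insert s(a,b) ω`
  have hU : ∀ x ∈ U, ∀ y, (openGraph (insert s(a, b) ω)).Adj x y → y ∈ U := by
    intro x hx y hxy
    rw [openGraph_adj] at hxy
    obtain ⟨hmem, hne⟩ := hxy
    by_cases hab : s(x, y) = s(a, b)
    · -- the flipped edge itself: `y ∈ {a, b}`
      have hy : y ∈ s(a, b) := by rw [← hab]; exact Sym2.mem_mk_right x y
      rcases Sym2.mem_iff.1 hy with rfl | rfl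
      · exact Or.inl (mem_openCluster_self _ _)
      · exact Or.inr (mem_openCluster_self _ _)
    · have hmem' : s(x, y) ∈ ω' := by
        rcases Set.mem_insert_iff.1 hmem with h | h
        · exact absurd h hab
        · exact ⟨h, hab⟩
      have hadj : (openGraph ω').Adj x y := (openGraph_adj ω' x y).2 ⟨hmem', hne⟩
      rcases hx with hx | hx
      · exact Or.inl (SimpleGraph.Reachable.trans hx hadj.reachable)
      · exact Or.inr (SimpleGraph.Reachable.trans hx hadj.reachable)
  exact Set.union_subset
    (openCluster_subset_of_closed (Or.inl (mem_openCluster_self _ _)) hU)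
    (openCluster_subset_of_closed (Or.inr (mem_openCluster_self _ _)) hU)

/-- Hence `C(a) ∪ C(b)` is the same for `ω`, `ω ∪ {ab}` and `ω ∖ {ab}`. [folklore] -/
theorem union_openCluster_insert_eq_self (ω : BondConfig V) (a b : V) :
    openCluster (insert s(a, b) ω) a ∪ openCluster (insert s(a, b) ω) b =
      openCluster ω a ∪ openCluster ω b := by
  refine Set.Subset.antisymm ?_
    (Set.union_subset_union (openCluster_mono (Set.subset_insert _ _) a)
      (openCluster_mono (Set.subset_insert _ _) b))
  rw [union_openCluster_insert_eq]
  exact Set.union_subset_union (openCluster_mono Set.sdiff_subset a) (openCluster_mono Set.sdiff_subset b)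

/-- `C(a) ∪ C(b)` is unchanged by closing the edge `{a, b}`. [folklore] -/
theorem union_openCluster_diff_eq_self (ω : BondConfig V) (a b : V) :
    openCluster (ω \ {s(a, b)}) a ∪ openCluster (ω \ {s(a, b)}) b =
      openCluster ω a ∪ openCluster ω b := by
  rw [← union_openCluster_insert_eq, union_openCluster_insert_eq_self]

/-- Both clusters at the endpoints are finite iff their union is. [folklore] -/
theorem finite_and_finite_iff_union {ω : BondConfig V} {a b : V} :
    (openCluster ω a).Finite ∧ (openCluster ω b).Finite ↔ (openCluster ω a ∪ openCluster ω b).Finite :=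
  ⟨fun h => h.1.union h.2, fun h => ⟨h.subset Set.subset_union_left, h.subset Set.subset_union_right⟩⟩

/-! #### Finite-cluster data: a countably-valued statistic carrying the cluster of a vertex and
the states of the edges touching it (used for measurability) -/

/-- The finite-cluster data type: `none` (infinite cluster) or the vertex set of the cluster
together with the open edges touching it. It is countable and carries the discrete σ-algebra.
[folklore] -/
structure CData (V : Type*) where
  /-- the data, if the cluster is finite -/
  val : Option (Finset V × Finset (Sym2 V))

/-- `CData.val` is injective. [folklore] -/
theorem CData.val_injective : Function.Injective (CData.val : CData V → _) := by
  rintro ⟨a⟩ ⟨b⟩ h; cases h; rfl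

/-- The discrete σ-algebra on the cluster data. [folklore] -/
instance : MeasurableSpace (CData V) := ⊤

/-- Every subset of the cluster data type is measurable. [folklore] -/
instance : MeasurableSingletonClass (CData V) := ⟨fun _ => MeasurableSpace.measurableSet_top⟩

/-- The cluster data type is countable (`V` countable). [folklore] -/
instance [Countable V] : Countable (CData V) := CData.val_injective.countable

variable (G) in
open Classical in
/-- The open edges of `G` touching the finite vertex set `S`. [folklore] -/
def openEdges [DecidableEq V] [G.LocallyFinite] (ω : BondConfig V) (S : Finset V) : Finset (Sym2 V) :=
  (LatticeModels.edgesTouching G S).filter fun e => e ∈ ω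

variable (G) in
open Classical in
/-- The closed edges of `G` touching the finite vertex set `S`. [folklore] -/
def closedEdges [DecidableEq V] [G.LocallyFinite] (ω : BondConfig V) (S : Finset V) : Finset (Sym2 V) :=
  (LatticeModels.edgesTouching G S).filter fun e => e ∉ ω

variable [DecidableEq V] [G.LocallyFinite]

/-- Membership in `openEdges`. [folklore] -/
theorem mem_openEdges {ω : BondConfig V} {S : Finset V} {e : Sym2 V} :
    e ∈ openEdges G ω S ↔ e ∈ LatticeModels.edgesTouching G S ∧ e ∈ ω := by
  classical
  exact Finset.mem_filter

/-- Membership in `closedEdges`. [folklore] -/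
theorem mem_closedEdges {ω : BondConfig V} {S : Finset V} {e : Sym2 V} :
    e ∈ closedEdges G ω S ↔ e ∈ LatticeModels.edgesTouching G S ∧ e ∉ ω := by
  classical
  exact Finset.mem_filter

/-- Every edge touching `S` is open or closed: `#open + #closed = #E(S)`. [folklore] -/
theorem card_openEdges_add_card_closedEdges (ω : BondConfig V) (S : Finset V) :
    (openEdges G ω S).card + (closedEdges G ω S).card = (LatticeModels.edgesTouching G S).card := by
  classical
  unfold openEdges closedEdges
  exact Finset.card_filter_add_card_filter_not _

variable (G) in
open Classical in
/-- The finite-cluster data of `x` in `ω`: the vertex set `C(x)` and the open edges of `G`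
touching it, if `C(x)` is finite. [folklore] -/
def cdata (ω : BondConfig V) (x : V) : CData V :=
  ⟨if h : (openCluster ω x).Finite then some (h.toFinset, openEdges G ω h.toFinset) else none⟩

/-- `cdata` of an infinite cluster is `none`. [folklore] -/
theorem cdata_of_infinite {ω : BondConfig V} {x : V} (h : (openCluster ω x).Infinite) :
    cdata G ω x = ⟨none⟩ := by
  simp [cdata, h.not_finite]

/-- `cdata` of a finite cluster. [folklore] -/
theorem cdata_of_finite {ω : BondConfig V} {x : V} (h : (openCluster ω x).Finite) :
    cdata G ω x = ⟨some (h.toFinset, openEdges G ω h.toFinset)⟩ := by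
  simp [cdata, h]

/-- Characterisation of the fibres of `cdata`. [folklore] -/
theorem cdata_eq_some_iff {ω : BondConfig V} {x : V} {S : Finset V} {T : Finset (Sym2 V)} :
    cdata G ω x = ⟨some (S, T)⟩ ↔ openCluster ω x = ↑S ∧ openEdges G ω S = T := by
  constructor
  · intro h
    by_cases hf : (openCluster ω x).Finite
    · rw [cdata_of_finite hf, CData.mk.injEq] at h
      have h' := Option.some_injective _ h
      rw [Prod.mk.injEq] at h'
      obtain ⟨h1, h2⟩ := h'
      subst h1
      exact ⟨(hf.coe_toFinset).symm, h2⟩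
    · rw [cdata_of_infinite hf, CData.mk.injEq] at h; exact absurd h (by simp)
  · rintro ⟨h1, h2⟩
    have hf : (openCluster ω x).Finite := by rw [h1]; exact S.finite_toSet
    rw [cdata_of_finite hf]
    have hS : hf.toFinset = S := by
      apply Finset.coe_injective
      rw [hf.coe_toFinset, h1]
    subst hS
    rw [h2]

/-- `cdata` of a finite cluster with vertex finset `S`. [folklore] -/
theorem cdata_eq_of_finite {ω : BondConfig V} {x : V} {S : Finset V} (hS : openCluster ω x = ↑S) :
    cdata G ω x = ⟨some (S, openEdges G ω S)⟩ :=
  cdata_eq_some_iff.2 ⟨hS, rfl⟩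

/-- `cdata = none` iff the cluster is infinite. [folklore] -/
theorem cdata_eq_none_iff {ω : BondConfig V} {x : V} : cdata G ω x = ⟨none⟩ ↔ ω ∈ percolatesAt x := by
  by_cases hf : (openCluster ω x).Finite
  · rw [cdata_of_finite hf, CData.mk.injEq]; simp [percolatesAt, hf]
  · rw [cdata_of_infinite hf]; simpa [percolatesAt] using hf

/-- **`cdata` is measurable** (`V` countable): each fibre is a countable intersection of
connection events and one-edge events. [folklore] -/
theorem measurable_cdata [Countable V] (x : V) : Measurable fun ω : BondConfig V => cdata G ω x := by
  classical
  refine measurable_to_countable' fun c => ?_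
  rcases c with ⟨_ | ⟨S, T⟩⟩
  · have : (fun ω : BondConfig V => cdata G ω x) ⁻¹' {⟨none⟩} = percolatesAt x := by
      ext ω; exact cdata_eq_none_iff
    rw [this]
    exact measurableSet_percolatesAt_holds x
  · have : (fun ω : BondConfig V => cdata G ω x) ⁻¹' {⟨some (S, T)⟩} =
        (⋂ y : V, {ω : BondConfig V | y ∈ openCluster ω x ↔ y ∈ S}) ∩
          ⋂ e : Sym2 V, {ω : BondConfig V | (e ∈ LatticeModels.edgesTouching G S ∧ e ∈ ω) ↔ e ∈ T} := by
      ext ω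
      simp only [Set.mem_preimage, Set.mem_singleton_iff, cdata_eq_some_iff, Set.mem_inter_iff,
        Set.mem_iInter, Set.mem_setOf_eq]
      constructor
      · rintro ⟨h1, h2⟩
        refine ⟨fun y => by rw [h1, Finset.mem_coe], fun e => ?_⟩
        rw [← h2, mem_openEdges]
      · rintro ⟨h1, h2⟩
        refine ⟨Set.ext fun y => (h1 y).trans Finset.mem_coe.symm, ?_⟩
        ext e
        rw [mem_openEdges]
        exact h2 e
    rw [this]
    refine (MeasurableSet.iInter fun y => ?_).inter (MeasurableSet.iInter fun e => ?_)
    · have hm : MeasurableSet {ω : BondConfig V | y ∈ openCluster ω x} := measurableSet_openConn_holds x y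
      by_cases hy : y ∈ S
      · convert hm using 2; simp [hy]
      · convert hm.compl using 2
        ext ω; simp [hy]
    · by_cases he : e ∈ LatticeModels.edgesTouching G S
      · by_cases heT : e ∈ T
        · convert (measurableSet_mem e : MeasurableSet {ω : BondConfig V | e ∈ ω}) using 2
          ext ω; simp [he, heT]
        · convert (measurableSet_mem e : MeasurableSet {ω : BondConfig V | e ∈ ω}).compl using 2
          ext ω; simp [he, heT]
      · by_cases heT : e ∈ T
        · convert (MeasurableSet.empty : MeasurableSet (∅ : Set (BondConfig V))) using 2
          ext ω; simp [he, heT]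
        · convert (MeasurableSet.univ : MeasurableSet (Set.univ : Set (BondConfig V))) using 2
          ext ω; simp [he, heT]

/-- Functions of finitely many cluster data are measurable. [folklore] -/
theorem measurable_comp_cdata [Countable V] {β : Type*} [MeasurableSpace β] (x : V) (φ : CData V → β) :
    Measurable fun ω : BondConfig V => φ (cdata G ω x) :=
  (measurable_from_top (f := φ)).comp (measurable_cdata x)

/-- Functions of the cluster data of two vertices are measurable. [folklore] -/
theorem measurable_comp_cdata₂ [Countable V] {β : Type*} [MeasurableSpace β] (x y : V)
    (φ : CData V → CData V → β) :
    Measurable fun ω : BondConfig V => φ (cdata G ω x) (cdata G ω y) := by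
  have h : Measurable fun ω : BondConfig V => (cdata G ω x, cdata G ω y) :=
    (measurable_cdata x).prodMk (measurable_cdata y)
  exact (measurable_of_countable (fun c : CData V × CData V => φ c.1 c.2)).comp h

/-! #### Flipping one edge: `E[1(e open)·F] = p·E[F]` for `F` not depending on `ω(e)` -/

omit [DecidableEq V] [G.LocallyFinite] in
/-- A measurable function not depending on the state of `e` is `σ(E ∖ {e})`-measurable.
[folklore] -/
theorem measurable_edgeSigma_compl_of_flip {e : Sym2 V} {F : BondConfig V → ℝ≥0∞} (hF : Measurable F)
    (hflip : ∀ ω, F (ω \ {e}) = F ω) : Measurable[edgeSigma ({e}ᶜ : Set (Sym2 V))] F := by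
  intro s hs
  refine DeterminedBy.measurableSet_edgeSigma ?_ (hF hs)
  rw [determinedBy_iff]
  intro ω ω' h
  simp only [Set.mem_preimage]
  rw [← hflip ω, ← hflip ω', Set.sdiff_eq, Set.sdiff_eq, h]

omit [DecidableEq V] [G.LocallyFinite] in
/-- **Resampling one edge** (product structure of `P_p`; the step "`F_e ∩ G_e` is independent of
the value of `ω(e)`" in Hutchcroft 2020, proof of Lemma 3.1, eq. (3.3)): if `F` does not depend
on the state of the edge `e ∈ E(G)`, then `E[1(e open)·F] = p·E[F]`.
[cite: Hutchcroft2020Locality, §3, proof of Lemma 3.1] -/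
theorem lintegral_mem_mul_of_flip [Countable V] (p : unitInterval) {e : Sym2 V} (he : e ∈ G.edgeSet)
    {F : BondConfig V → ℝ≥0∞} (hF : Measurable F) (hflip : ∀ ω, F (ω \ {e}) = F ω) :
    ∫⁻ ω, {ω : BondConfig V | e ∈ ω}.indicator 1 ω * F ω ∂(bondPercolation G p) =
      ENNReal.ofReal p * ∫⁻ ω, F ω ∂(bondPercolation G p) := by
  set P := bondPercolation G p with hP
  have hdet : DeterminedBy {ω : BondConfig V | e ∈ ω} ({e} : Set (Sym2 V)) := by
    rw [determinedBy_iff]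
    intro ω ω' h
    simp only [Set.mem_setOf_eq]
    constructor
    · intro hω; exact ((Set.ext_iff.1 h e).1 ⟨hω, rfl⟩).1
    · intro hω; exact ((Set.ext_iff.1 h e).2 ⟨hω, rfl⟩).1
  have hA : MeasurableSet[edgeSigma ({e} : Set (Sym2 V))] {ω : BondConfig V | e ∈ ω} :=
    hdet.measurableSet_edgeSigma (measurableSet_mem e)
  have hf : Measurable[edgeSigma ({e} : Set (Sym2 V))]
      (fun ω : BondConfig V => ({ω : BondConfig V | e ∈ ω}).indicator (1 : BondConfig V → ℝ≥0∞) ω) :=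
    (@measurable_const ℝ≥0∞ (BondConfig V) _ (edgeSigma ({e} : Set (Sym2 V))) 1).indicator hA
  have hg := measurable_edgeSigma_compl_of_flip hF hflip
  have hind : IndepFun (fun ω : BondConfig V => ({ω : BondConfig V | e ∈ ω}).indicator (1 : BondConfig V → ℝ≥0∞) ω)
      F P := by
    rw [IndepFun_iff_Indep]
    exact indep_of_indep_of_le_right
      (indep_of_indep_of_le_left (bondPercolation_indep_edgeSigma G p disjoint_compl_right) hf.comap_le)
      hg.comap_le
  have hfm : Measurable fun ω : BondConfig V => ({ω : BondConfig V | e ∈ ω}).indicator (1 : BondConfig V → ℝ≥0∞) ω :=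
    measurable_const.indicator (measurableSet_mem e)
  have h := lintegral_mul_eq_lintegral_mul_lintegral_of_indepFun' hfm.aemeasurable hF.aemeasurable hind
  simp only [Pi.mul_apply] at h
  rw [h, lintegral_indicator_one (measurableSet_mem e)]
  congr 1
  rw [← ofReal_measureReal (measure_ne_top P _)]
  congr 1
  exact bondPercolation_cylinder G p he

omit [DecidableEq V] [G.LocallyFinite] in
/-- Companion: `E[1(e closed)·F] = (1 - p)·E[F]`.
[cite: Hutchcroft2020Locality, §3, proof of Lemma 3.1] -/
theorem lintegral_notMem_mul_of_flip [Countable V] (p : unitInterval) {e : Sym2 V} (he : e ∈ G.edgeSet)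
    {F : BondConfig V → ℝ≥0∞} (hF : Measurable F) (hflip : ∀ ω, F (ω \ {e}) = F ω)
    (hfin : ∫⁻ ω, F ω ∂(bondPercolation G p) ≠ ∞) :
    ∫⁻ ω, {ω : BondConfig V | e ∉ ω}.indicator 1 ω * F ω ∂(bondPercolation G p) =
      ENNReal.ofReal (1 - p) * ∫⁻ ω, F ω ∂(bondPercolation G p) := by
  set P := bondPercolation G p with hP
  have hsplit : ∀ ω : BondConfig V, F ω = {ω : BondConfig V | e ∈ ω}.indicator 1 ω * F ω +
      {ω : BondConfig V | e ∉ ω}.indicator 1 ω * F ω := by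
    intro ω
    by_cases h : e ∈ ω
    · simp [Set.indicator_of_mem (show ω ∈ {ω : BondConfig V | e ∈ ω} from h),
        Set.indicator_of_notMem (show ω ∉ {ω : BondConfig V | e ∉ ω} from fun h' => h' h)]
    · simp [Set.indicator_of_notMem (show ω ∉ {ω : BondConfig V | e ∈ ω} from h),
        Set.indicator_of_mem (show ω ∈ {ω : BondConfig V | e ∉ ω} from h)]
  have htot : ∫⁻ ω, F ω ∂P = ENNReal.ofReal p * ∫⁻ ω, F ω ∂P +
      ∫⁻ ω, {ω : BondConfig V | e ∉ ω}.indicator 1 ω * F ω ∂P := by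
    conv_lhs => rw [lintegral_congr hsplit]
    have hm1 : Measurable fun ω : BondConfig V => {ω : BondConfig V | e ∈ ω}.indicator 1 ω * F ω :=
      ((measurable_const (a := (1 : ℝ≥0∞))).indicator (measurableSet_mem e)).mul hF
    rw [lintegral_add_left hm1, lintegral_mem_mul_of_flip p he hF hflip]
  have hp1 : ENNReal.ofReal (1 - p) = 1 - ENNReal.ofReal p := by
    rw [ENNReal.ofReal_sub _ p.2.1, ENNReal.ofReal_one]
  rw [hp1, ENNReal.sub_mul fun _ _ => hfin, one_mul]
  refine ENNReal.eq_sub_of_add_eq' hfin ?_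
  rw [add_comm]; exact htot.symm

end General


/-! ### The hypercubic lattice: edge labels, degree bound, translations -/

section Zd

open LatticeModels

variable {d : ℕ}

/-- The edge of `ℤ^d` with label `(v, i)`: `{v, v + eᵢ}`. [folklore] -/
def edgeOf (ℓ : Site d × Fin d) : Sym2 (Site d) := s(ℓ.1, ℓ.1 + Pi.single ℓ.2 1)

/-- Labels name edges of `ℤ^d`. [folklore] -/
theorem edgeOf_mem_edgeSet (ℓ : Site d × Fin d) : edgeOf ℓ ∈ (zdGraph d).edgeSet := by
  rw [edgeOf, SimpleGraph.mem_edgeSet, zdGraph_adj_iff]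
  exact ⟨ℓ.2, Or.inl rfl⟩

/-- Distinct labels name distinct edges. [folklore] -/
theorem edgeOf_injective : Function.Injective (edgeOf : Site d × Fin d → Sym2 (Site d)) := by
  rintro ⟨v, i⟩ ⟨v', j⟩ h
  simp only [edgeOf, Sym2.eq_iff] at h
  rcases h with ⟨h1, h2⟩ | ⟨h1, h2⟩
  · subst h1
    have hs : (Pi.single i (1 : ℤ) : Site d) = Pi.single j 1 := add_left_cancel h2
    have hij : i = j := by
      by_contra hne
      have := congr_fun hs i
      rw [Pi.single_eq_same, Pi.single_eq_of_ne hne] at this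
      exact one_ne_zero this
    subst hij
    rfl
  · exfalso
    have h0 : (Pi.single j (1 : ℤ) : Site d) + Pi.single i 1 = 0 := by
      have : v' + (Pi.single j 1 + Pi.single i 1) = v' + 0 := by
        rw [← add_assoc, ← h1, add_zero]; exact h2
      exact add_left_cancel this
    have := congr_fun h0 i
    simp only [Pi.add_apply, Pi.single_eq_same, Pi.zero_apply] at this
    by_cases hij : i = j
    · subst hij
      rw [Pi.single_eq_same] at this
      omega
    · rw [Pi.single_eq_of_ne hij] at this
      omega

/-- Every edge of `ℤ^d` has a label. [folklore] -/
theorem exists_edgeOf_eq {e : Sym2 (Site d)} (he : e ∈ (zdGraph d).edgeSet) : ∃ ℓ, edgeOf ℓ = e := by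
  induction e using Sym2.ind with
  | h a b =>
    rw [SimpleGraph.mem_edgeSet, zdGraph_adj_iff] at he
    obtain ⟨i, h | h⟩ := he
    · exact ⟨(a, i), by rw [edgeOf, h]⟩
    · exact ⟨(b, i), by rw [edgeOf, ← h, Sym2.eq_swap]⟩

/-- The labels name exactly the edges of `ℤ^d`. [folklore] -/
theorem range_edgeOf : Set.range (edgeOf : Site d × Fin d → Sym2 (Site d)) = (zdGraph d).edgeSet := by
  ext e
  constructor
  · rintro ⟨ℓ, rfl⟩; exact edgeOf_mem_edgeSet ℓ
  · intro he
    obtain ⟨ℓ, hℓ⟩ := exists_edgeOf_eq he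
    exact ⟨ℓ, hℓ⟩

/-- Counting edges through labels: for `F ⊆ E(ℤ^d)`, `#{ℓ | edgeOf ℓ ∈ F} = #F`. [folklore] -/
theorem ncard_setOf_edgeOf_mem {F : Set (Sym2 (Site d))} (hF : F ⊆ (zdGraph d).edgeSet) :
    {ℓ : Site d × Fin d | edgeOf ℓ ∈ F}.ncard = F.ncard :=
  Set.ncard_preimage_of_injective_subset_range edgeOf_injective (by rwa [range_edgeOf])

/-- Finitely many labels name edges of a finite set. [folklore] -/
theorem finite_setOf_edgeOf_mem {F : Set (Sym2 (Site d))} (hF : F.Finite) :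
    {ℓ : Site d × Fin d | edgeOf ℓ ∈ F}.Finite :=
  hF.preimage edgeOf_injective.injOn

/-- The edge with label `ℓ` touches `K` iff one of its two endpoints lies in `K`. [folklore] -/
theorem edgeOf_mem_touch_iff {K : Set (Site d)} {ℓ : Site d × Fin d} :
    edgeOf ℓ ∈ touch (zdGraph d) K ↔ ℓ.1 ∈ K ∨ ℓ.1 + Pi.single ℓ.2 1 ∈ K := by
  rw [mem_touch]
  constructor
  · rintro ⟨-, v, hv, hvK⟩
    rw [edgeOf, Sym2.mem_iff] at hv
    rcases hv with rfl | rfl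
    · exact Or.inl hvK
    · exact Or.inr hvK
  · rintro (h | h)
    · exact ⟨edgeOf_mem_edgeSet ℓ, _, by rw [edgeOf]; exact Sym2.mem_mk_left _ _, h⟩
    · exact ⟨edgeOf_mem_edgeSet ℓ, _, by rw [edgeOf]; exact Sym2.mem_mk_right _ _, h⟩

/-- **Degree bound**: a finite `K ⊆ ℤ^d` touches at most `2d·|K|` edges. [folklore] -/
theorem ncard_touch_le {K : Set (Site d)} (hK : K.Finite) :
    (touch (zdGraph d) K).ncard ≤ 2 * d * K.ncard := by
  classical
  obtain ⟨Kf, rfl⟩ := hK.exists_finset_coe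
  rw [touch_coe_eq, Set.ncard_coe_finset, Set.ncard_coe_finset, edgesTouching]
  calc (Kf.biUnion fun x => (zdGraph d).incidenceFinset x).card
      ≤ ∑ x ∈ Kf, ((zdGraph d).incidenceFinset x).card := Finset.card_biUnion_le
    _ = ∑ x ∈ Kf, 2 * d := Finset.sum_congr rfl fun x _ => by
        rw [SimpleGraph.card_incidenceFinset_eq_degree, ← SimpleGraph.card_neighborFinset_eq_degree]
        exact card_neighborFinset_zdGraph_holds x
    _ = 2 * d * Kf.card := by rw [Finset.sum_const, smul_eq_mul, mul_comm]

/-- A nonempty set touches at least one edge (`d ≥ 1`). [folklore] -/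
theorem one_le_ncard_touch (hd : 1 ≤ d) {K : Set (Site d)} (hK : K.Finite) {v : Site d} (hv : v ∈ K) :
    1 ≤ (touch (zdGraph d) K).ncard := by
  rw [Nat.one_le_iff_ne_zero, Ne, Set.ncard_eq_zero (touch_finite hK)]
  intro h
  have : edgeOf (v, ⟨0, hd⟩) ∈ touch (zdGraph d) K := edgeOf_mem_touch_iff.2 (Or.inl hv)
  rw [h] at this
  exact this

/-- An infinite set touches infinitely many edges (`d ≥ 1`). [folklore] -/
theorem touch_infinite (hd : 1 ≤ d) {K : Set (Site d)} (hK : K.Infinite) : (touch (zdGraph d) K).Infinite := by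
  have hsub : (fun v : Site d => edgeOf (v, ⟨0, hd⟩)) '' K ⊆ touch (zdGraph d) K := by
    rintro _ ⟨v, hv, rfl⟩
    exact edgeOf_mem_touch_iff.2 (Or.inl hv)
  refine Set.Infinite.mono hsub (hK.image ?_)
  intro v _ v' _ h
  have := edgeOf_injective h
  simpa using this

/-! #### Translations -/

/-- The configuration shift `ω ↦ ω + u` of `BondPercolationSymmetry.lean`. [folklore] -/
abbrev shiftConfig (u : Site d) : BondConfig (Site d) ≃ᵐ BondConfig (Site d) :=
  BondConfig.relabel (sym2Equiv (Site.shift u))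

/-- `shiftConfig u ω = ω + u` is the image of `ω` under `e ↦ e + u`. [folklore] -/
theorem shiftConfig_apply (u : Site d) (ω : BondConfig (Site d)) :
    shiftConfig u ω = Sym2.map (· + u) '' ω := rfl

/-- `e + u ∈ ω + u ↔ e ∈ ω`. [folklore] -/
theorem map_add_mem_shiftConfig_iff (u : Site d) (ω : BondConfig (Site d)) (e : Sym2 (Site d)) :
    Sym2.map (· + u) e ∈ shiftConfig u ω ↔ e ∈ ω := by
  rw [shiftConfig_apply]
  exact (Sym2.map.injective (add_left_injective u)).mem_set_image

/-- The edge with label `(v + u, i)` is the translate by `u` of the edge with label `(v, i)`. [folklore] -/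
theorem edgeOf_shift (u : Site d) (ℓ : Site d × Fin d) :
    edgeOf (ℓ.1 + u, ℓ.2) = Sym2.map (· + u) (edgeOf ℓ) := by
  simp only [edgeOf, Sym2.map_mk, add_right_comm]

/-- The translated edge is open in the translated configuration iff the edge is open. [folklore] -/
theorem edgeOf_shift_mem_iff (u : Site d) (ω : BondConfig (Site d)) (ℓ : Site d × Fin d) :
    edgeOf (ℓ.1 + u, ℓ.2) ∈ shiftConfig u ω ↔ edgeOf ℓ ∈ ω := by
  rw [edgeOf_shift, map_add_mem_shiftConfig_iff]

/-- `C_{ω+u}(x + u) = C_ω(x) + u`. [folklore] -/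
theorem openCluster_shiftConfig (u : Site d) (ω : BondConfig (Site d)) (x : Site d) :
    openCluster (shiftConfig u ω) (x + u) = (· + u) '' openCluster ω x :=
  openCluster_relabel_shift u ω x

/-- `y + u ∈ C_{ω+u}(x + u) ↔ y ∈ C_ω(x)`. [folklore] -/
theorem add_mem_openCluster_shiftConfig_iff (u : Site d) (ω : BondConfig (Site d)) (x y : Site d) :
    y + u ∈ openCluster (shiftConfig u ω) (x + u) ↔ y ∈ openCluster ω x := by
  rw [openCluster_shiftConfig]
  exact (add_left_injective u).mem_set_image

/-- Translation preserves finiteness of clusters. [folklore] -/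
theorem finite_openCluster_shiftConfig_iff (u : Site d) (ω : BondConfig (Site d)) (x : Site d) :
    (openCluster (shiftConfig u ω) (x + u)).Finite ↔ (openCluster ω x).Finite := by
  rw [openCluster_shiftConfig]
  exact Set.finite_image_iff (add_left_injective u).injOn

/-- Translation preserves the number of vertices of clusters. [folklore] -/
theorem ncard_openCluster_shiftConfig (u : Site d) (ω : BondConfig (Site d)) (x : Site d) :
    (openCluster (shiftConfig u ω) (x + u)).ncard = (openCluster ω x).ncard := by
  rw [openCluster_shiftConfig]
  exact Set.ncard_image_of_injective _ (add_left_injective u)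

/-- Translation preserves the edge set of `ℤ^d`. [folklore] -/
theorem map_add_mem_edgeSet_iff (u : Site d) (e : Sym2 (Site d)) :
    Sym2.map (· + u) e ∈ (zdGraph d).edgeSet ↔ e ∈ (zdGraph d).edgeSet := by
  induction e using Sym2.ind with
  | h a b =>
    simp only [Sym2.map_mk, SimpleGraph.mem_edgeSet]
    exact zdGraph_adj_shift_iff u a b

/-- `E(K + u) = E(K) + u`. [folklore] -/
theorem touch_image_add (u : Site d) (K : Set (Site d)) :
    touch (zdGraph d) ((· + u) '' K) = Sym2.map (· + u) '' touch (zdGraph d) K := by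
  ext e
  constructor
  · rintro ⟨he, v, hv, ⟨w, hw, rfl⟩⟩
    -- `e ∋ w + u`; write `e = s(w + u, z)` and pull back
    obtain ⟨z, rfl⟩ := Sym2.mem_iff_exists.1 hv
    refine ⟨s(w, z - u), ⟨?_, w, Sym2.mem_mk_left _ _, hw⟩, ?_⟩
    · have := (map_add_mem_edgeSet_iff u s(w, z - u)).1
      rw [Sym2.map_mk, sub_add_cancel] at this
      exact this he
    · rw [Sym2.map_mk, sub_add_cancel]
  · rintro ⟨e', ⟨he', v, hv, hvK⟩, rfl⟩
    refine ⟨(map_add_mem_edgeSet_iff u e').2 he', v + u, ?_, ⟨v, hvK, rfl⟩⟩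
    exact Sym2.mem_map.2 ⟨v, hv, rfl⟩

/-- `|E(K + u)| = |E(K)|`. [folklore] -/
theorem ncard_touch_image_add (u : Site d) (K : Set (Site d)) :
    (touch (zdGraph d) ((· + u) '' K)).ncard = (touch (zdGraph d) K).ncard := by
  rw [touch_image_add]
  exact Set.ncard_image_of_injective _ (Sym2.map.injective (add_left_injective u))

/-- Open edges touching a shifted set in the shifted configuration. [folklore] -/
theorem sep_touch_image_add_mem (u : Site d) (ω : BondConfig (Site d)) (K : Set (Site d)) :
    {e ∈ touch (zdGraph d) ((· + u) '' K) | e ∈ shiftConfig u ω} =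
      Sym2.map (· + u) '' {e ∈ touch (zdGraph d) K | e ∈ ω} := by
  rw [touch_image_add]
  ext e
  constructor
  · rintro ⟨⟨e', he', rfl⟩, hmem⟩
    exact ⟨e', ⟨he', (map_add_mem_shiftConfig_iff u ω e').1 hmem⟩, rfl⟩
  · rintro ⟨e', ⟨he', hmem⟩, rfl⟩
    exact ⟨⟨e', he', rfl⟩, (map_add_mem_shiftConfig_iff u ω e').2 hmem⟩

/-- Closed edges touching a shifted set in the shifted configuration. [folklore] -/
theorem sep_touch_image_add_notMem (u : Site d) (ω : BondConfig (Site d)) (K : Set (Site d)) :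
    {e ∈ touch (zdGraph d) ((· + u) '' K) | e ∉ shiftConfig u ω} =
      Sym2.map (· + u) '' {e ∈ touch (zdGraph d) K | e ∉ ω} := by
  rw [touch_image_add]
  ext e
  constructor
  · rintro ⟨⟨e', he', rfl⟩, hmem⟩
    exact ⟨e', ⟨he', fun h => hmem ((map_add_mem_shiftConfig_iff u ω e').2 h)⟩, rfl⟩
  · rintro ⟨e', ⟨he', hmem⟩, rfl⟩
    exact ⟨⟨e', he', rfl⟩, fun h => hmem ((map_add_mem_shiftConfig_iff u ω e').1 h)⟩

/-- `P_p` on `ℤ^d` is shift invariant (integral form). [folklore] -/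
theorem lintegral_shiftConfig (u : Site d) (p : unitInterval) (f : BondConfig (Site d) → ℝ≥0∞) :
    ∫⁻ ω, f (shiftConfig u ω) ∂(bondPercolation (zdGraph d) p) = ∫⁻ ω, f ω ∂(bondPercolation (zdGraph d) p) := by
  rw [← lintegral_map_equiv f (shiftConfig u), bondPercolation_map_shift]

end Zd

/-! ## Part D. The two-ghost argument on `ℤ^d`

Throughout: `d ≥ 1`, `G = zdGraph d`, `P = bondPercolation G p` with `0 < p ≤ 1`, `n ≥ 1`, and the
ghost intensity is `h = 1/n`; the ghost field is integrated out, leaving the weight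
`w(t) = 1 - exp(-t/n)` of a finite cluster touching `t` edges. -/

section Main

open LatticeModels

variable {d : ℕ}

/-! ### The weight `w(t) = 1 - e^{-t/n}` -/

/-- `w_n(t) = 1 - exp(-t/n)`: the probability that a set of `t` edges contains a green edge of
the ghost field of intensity `h = 1/n` (Hutchcroft 2020, §1.1).
[cite: Hutchcroft2020Locality, §1.1 (ghost field of intensity h)] -/
def wt (n t : ℕ) : ℝ := 1 - Real.exp (-((t : ℝ) / n))

/-- `1 - w(t) = exp(-t/n)`. [folklore] -/
theorem one_sub_wt (n t : ℕ) : 1 - wt n t = Real.exp (-((t : ℝ) / n)) := by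
  simp [wt]

/-- `0 ≤ w(t)`. [folklore] -/
theorem wt_nonneg (n t : ℕ) : 0 ≤ wt n t := by
  rw [wt, sub_nonneg]
  refine Real.exp_le_one_iff.2 ?_
  have : (0 : ℝ) ≤ (t : ℝ) / n := by positivity
  linarith

/-- `w(t) ≤ 1`. [folklore] -/
theorem wt_le_one (n t : ℕ) : wt n t ≤ 1 := by
  rw [wt]; linarith [Real.exp_pos (-((t : ℝ) / n))]

/-- `w` is monotone. [folklore] -/
theorem wt_mono (n : ℕ) {s t : ℕ} (h : s ≤ t) : wt n s ≤ wt n t := by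
  rw [wt, wt]
  have : Real.exp (-((t : ℝ) / n)) ≤ Real.exp (-((s : ℝ) / n)) := by
    refine Real.exp_le_exp.2 ?_
    have hst : (s : ℝ) ≤ t := by exact_mod_cast h
    have hn : (0 : ℝ) ≤ (n : ℝ)⁻¹ := by positivity
    rw [neg_le_neg_iff, div_eq_mul_inv, div_eq_mul_inv]
    exact mul_le_mul_of_nonneg_right hst hn
  linarith

/-- `w(t) ≤ t/n` (`1 - e^{-x} ≤ x`). [folklore] -/
theorem wt_le_div (n t : ℕ) : wt n t ≤ (t : ℝ) / n := by
  rw [wt]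
  have := Real.add_one_le_exp (-((t : ℝ) / n))
  linarith

/-- The FKG-substitute: `w(a)·w(b) + w(m) ≤ w(a) + w(b)` whenever `m ≤ a + b`
(i.e. `1 - w(m) ≥ (1 - w(a))(1 - w(b))`).
[cite: Hutchcroft2020Locality, Cor. 1.7 (proof, §3 p. 9)] -/
theorem wt_mul_add_le (n : ℕ) {a b m : ℕ} (h : m ≤ a + b) :
    wt n a * wt n b + wt n m ≤ wt n a + wt n b := by
  have hm := wt_mono n h
  have key : wt n a * wt n b + wt n (a + b) = wt n a + wt n b := by
    have e : Real.exp (-(((a + b : ℕ) : ℝ) / n)) = Real.exp (-((a : ℝ) / n)) * Real.exp (-((b : ℝ) / n)) := by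
      rw [← Real.exp_add]; congr 1; push_cast; ring
    simp only [wt, e]; ring
  linarith

/-- `w(n) ≥ 1/2` (`e ≥ 2`). [folklore] -/
theorem half_le_wt_self {n : ℕ} (hn : 1 ≤ n) : (1 / 2 : ℝ) ≤ wt n n := by
  rw [wt]
  have hn' : (n : ℝ) ≠ 0 := by exact_mod_cast (show n ≠ 0 by omega)
  rw [div_self hn']
  have h2 : (2 : ℝ) ≤ Real.exp 1 := by have := Real.add_one_le_exp (1 : ℝ); linarith
  have : Real.exp (-1) ≤ 1 / 2 := by
    rw [Real.exp_neg]
    rw [inv_le_comm₀ (Real.exp_pos 1) (by norm_num)]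
    linarith
  linarith

/-! ### Cluster statistics -/

/-- `|E(C(x))|`: the number of edges touching the cluster of `x` (`0` if infinite).
[cite: Hutchcroft2020Locality, §1 (E(K_v))] -/
def tE (ω : BondConfig (Site d)) (x : Site d) : ℕ := (touch (zdGraph d) (openCluster ω x)).ncard

/-- The number of OPEN edges touching `C(x)` (Hutchcroft's `|E_∘(K)|`).
[cite: Hutchcroft2020Locality, §3 (E_∘(H))] -/
def nOp (ω : BondConfig (Site d)) (x : Site d) : ℕ := {e ∈ touch (zdGraph d) (openCluster ω x) | e ∈ ω}.ncard

/-- The number of CLOSED edges touching `C(x)` (Hutchcroft's `|∂K|`).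
[cite: Hutchcroft2020Locality, §3 (∂H)] -/
def nCl (ω : BondConfig (Site d)) (x : Site d) : ℕ := {e ∈ touch (zdGraph d) (openCluster ω x) | e ∉ ω}.ncard

/-- `|C(x)|`, the number of vertices (`0` if infinite). [folklore] -/
def nK (ω : BondConfig (Site d)) (x : Site d) : ℕ := (openCluster ω x).ncard

/-- Hutchcroft's `h_p(K) = p|∂K| - (1-p)|E_∘(K)|` for `K = C(x)`.
[cite: Hutchcroft2020Locality, §3 (h_p(H))] -/
def hp (p : ℝ) (ω : BondConfig (Site d)) (x : Site d) : ℝ := p * nCl ω x - (1 - p) * nOp ω x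

/-- `|E_∘(K)| + |∂K| = |E(K)|` for a finite cluster `K`. [folklore] -/
theorem nOp_add_nCl {ω : BondConfig (Site d)} {x : Site d} (hf : (openCluster ω x).Finite) :
    nOp ω x + nCl ω x = tE ω x := by
  have hfin := touch_finite (G := zdGraph d) hf
  have hdisj : Disjoint {e ∈ touch (zdGraph d) (openCluster ω x) | e ∈ ω}
      {e ∈ touch (zdGraph d) (openCluster ω x) | e ∉ ω} :=
    Set.disjoint_left.2 fun e h1 h2 => h2.2 h1.2
  rw [nOp, nCl, tE, ← Set.ncard_union_eq hdisj (hfin.subset fun e h => h.1) (hfin.subset fun e h => h.1)]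
  congr 1
  ext e; simp only [Set.mem_union, Set.mem_setOf_eq]; tauto

/-- In terms of the finset data: the statistics of a finite cluster. [folklore] -/
theorem stats_eq_of_finite {ω : BondConfig (Site d)} {x : Site d} {S : Finset (Site d)}
    (hS : openCluster ω x = ↑S) :
    tE ω x = (edgesTouching (zdGraph d) S).card ∧ nOp ω x = (openEdges (zdGraph d) ω S).card ∧
      nCl ω x = (closedEdges (zdGraph d) ω S).card ∧ nK ω x = S.card := by
  have h1 : touch (zdGraph d) (openCluster ω x) = ↑(edgesTouching (zdGraph d) S) := by
    rw [hS, touch_coe_eq]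
  refine ⟨?_, ?_, ?_, ?_⟩
  · rw [tE, h1, Set.ncard_coe_finset]
  · rw [nOp, h1]
    have : {e ∈ (↑(edgesTouching (zdGraph d) S) : Set (Sym2 (Site d))) | e ∈ ω} =
        ↑(openEdges (zdGraph d) ω S) := by
      ext e; simp [mem_openEdges]
    rw [this, Set.ncard_coe_finset]
  · rw [nCl, h1]
    have : {e ∈ (↑(edgesTouching (zdGraph d) S) : Set (Sym2 (Site d))) | e ∉ ω} =
        ↑(closedEdges (zdGraph d) ω S) := by
      ext e; simp [mem_closedEdges]
    rw [this, Set.ncard_coe_finset]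
  · rw [nK, hS, Set.ncard_coe_finset]

open Classical in
/-- **Measurability of functions of the cluster statistics.** [folklore] -/
theorem measurable_finStats {β : Type*} [MeasurableSpace β] (x : Site d) {c : β} (Φ : ℕ → ℕ → ℕ → ℕ → β) :
    Measurable fun ω : BondConfig (Site d) =>
      if (openCluster ω x).Finite then Φ (tE ω x) (nOp ω x) (nCl ω x) (nK ω x) else c := by
  classical
  let Φ' : CData (Site d) → β := fun cd => match cd with
    | ⟨some (S, T)⟩ => Φ (edgesTouching (zdGraph d) S).card T.card ((edgesTouching (zdGraph d) S).card - T.card) S.card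
    | ⟨none⟩ => c
  have h : (fun ω : BondConfig (Site d) =>
      if (openCluster ω x).Finite then Φ (tE ω x) (nOp ω x) (nCl ω x) (nK ω x) else c) =
      fun ω => Φ' (cdata (zdGraph d) ω x) := by
    funext ω
    by_cases hf : (openCluster ω x).Finite
    · rw [if_pos hf, cdata_eq_of_finite (hf.coe_toFinset).symm]
      obtain ⟨h1, h2, h3, h4⟩ := stats_eq_of_finite (hf.coe_toFinset).symm
      simp only [Φ', h1, h2, h3, h4]
      congr 1
      have := card_openEdges_add_card_closedEdges (G := zdGraph d) ω hf.toFinset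
      omega
    · rw [if_neg hf, cdata_of_infinite hf]
  rw [h]
  exact measurable_comp_cdata x Φ'

/-- `{C(x) finite}` is measurable. [folklore] -/
theorem measurableSet_finite_openCluster (x : Site d) :
    MeasurableSet {ω : BondConfig (Site d) | (openCluster ω x).Finite} := by
  have : {ω : BondConfig (Site d) | (openCluster ω x).Finite} = (percolatesAt x)ᶜ := by
    ext ω; simp [percolatesAt]
  rw [this]
  exact (measurableSet_percolatesAt_holds x).compl

/-- `{y ∈ C(x)}` is measurable. [folklore] -/
theorem measurableSet_mem_openCluster (x y : Site d) :
    MeasurableSet {ω : BondConfig (Site d) | y ∈ openCluster ω x} :=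
  measurableSet_openConn_holds x y

/-! ### Shift invariance of the statistics -/

/-- `|E(C(x))|` is translation invariant. [folklore] -/
theorem tE_shift (u : Site d) (ω : BondConfig (Site d)) (x : Site d) :
    tE (shiftConfig u ω) (x + u) = tE ω x := by
  rw [tE, tE, openCluster_shiftConfig, ncard_touch_image_add]

/-- `|E_∘(C(x))|` is translation invariant. [folklore] -/
theorem nOp_shift (u : Site d) (ω : BondConfig (Site d)) (x : Site d) :
    nOp (shiftConfig u ω) (x + u) = nOp ω x := by
  rw [nOp, nOp, openCluster_shiftConfig, sep_touch_image_add_mem]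
  exact Set.ncard_image_of_injective _ (Sym2.map.injective (add_left_injective u))

/-- `|∂C(x)|` is translation invariant. [folklore] -/
theorem nCl_shift (u : Site d) (ω : BondConfig (Site d)) (x : Site d) :
    nCl (shiftConfig u ω) (x + u) = nCl ω x := by
  rw [nCl, nCl, openCluster_shiftConfig, sep_touch_image_add_notMem]
  exact Set.ncard_image_of_injective _ (Sym2.map.injective (add_left_injective u))

/-- `|C(x)|` is translation invariant. [folklore] -/
theorem nK_shift (u : Site d) (ω : BondConfig (Site d)) (x : Site d) :
    nK (shiftConfig u ω) (x + u) = nK ω x :=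
  ncard_openCluster_shiftConfig u ω x

/-- `h_p(C(x))` is translation invariant. [folklore] -/
theorem hp_shift (p : ℝ) (u : Site d) (ω : BondConfig (Site d)) (x : Site d) :
    hp p (shiftConfig u ω) (x + u) = hp p ω x := by
  rw [hp, hp, nOp_shift, nCl_shift]

/-! ### Step 1. The AKN inequality at one edge (Hutchcroft 2020, proof of Lemma 3.1, (3.1)–(3.4))

For the edge with label `ℓ = (v, i)`, i.e. `e = {a, b}` with tail `a = v` and head `b = v + eᵢ`,
and with the ghost field integrated out (weights `w`), we bound the "target"
`1(e closed, a ↮ b, one of C(a), C(b) finite)·W_a·W_b` (`W = w(|E(C)|)`, or `1` for an infinite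
cluster) by `N^cl_e - 1(e closed)·G_e` pointwise, where `N^cl_e` counts (with weights) the finite
clusters touching the closed edge `e` and `G_e = 1(C(a) ∪ C(b) finite)·w(|E(C(a) ∪ C(b))|)`
does not depend on `ω(e)`; resampling `e` turns `E[1(e closed) G_e]` into
`((1-p)/p)·E[1(e open) G_e] = ((1-p)/p)·E[N^op_e]`. -/

/-- The head `v + eᵢ` of the edge with label `(v, i)` (its tail is `v`). [folklore] -/
def headOf (ℓ : Site d × Fin d) : Site d := ℓ.1 + Pi.single ℓ.2 1

/-- The edge with label `ℓ` joins the tail `ℓ.1` to the head `headOf ℓ`. [folklore] -/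
theorem edgeOf_eq (ℓ : Site d × Fin d) : edgeOf ℓ = s(ℓ.1, headOf ℓ) := rfl

/-- Tail and head differ. [folklore] -/
theorem headOf_ne (ℓ : Site d × Fin d) : ℓ.1 ≠ headOf ℓ := by
  intro h
  have := congr_fun h ℓ.2
  simp [headOf] at this

/-- `{0,1}`-valued indicator of an event. [folklore] -/
def ind (s : Set (BondConfig (Site d))) : BondConfig (Site d) → ℝ≥0∞ := s.indicator 1

/-- `ind s ω = 1` on `s`. [folklore] -/
theorem ind_of_mem {s : Set (BondConfig (Site d))} {ω : BondConfig (Site d)} (h : ω ∈ s) : ind s ω = 1 :=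
  Set.indicator_of_mem h _

/-- `ind s ω = 0` off `s`. [folklore] -/
theorem ind_of_notMem {s : Set (BondConfig (Site d))} {ω : BondConfig (Site d)} (h : ω ∉ s) : ind s ω = 0 :=
  Set.indicator_of_notMem h _

/-- `ind s ≤ 1`. [folklore] -/
theorem ind_le_one (s : Set (BondConfig (Site d))) (ω : BondConfig (Site d)) : ind s ω ≤ 1 := by
  by_cases h : ω ∈ s
  · rw [ind_of_mem h]
  · rw [ind_of_notMem h]; exact zero_le_one

/-- Indicators of measurable events are measurable. [folklore] -/
theorem measurable_ind {s : Set (BondConfig (Site d))} (hs : MeasurableSet s) : Measurable (ind s) :=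
  measurable_const.indicator hs

open Classical in
/-- `W_x = w(|E(C(x))|)` if `C(x)` is finite, `1` if it is infinite. [folklore] -/
def Wfin (n : ℕ) (ω : BondConfig (Site d)) (x : Site d) : ℝ≥0∞ :=
  if (openCluster ω x).Finite then ENNReal.ofReal (wt n (tE ω x)) else 1

open Classical in
/-- `w(|E(U)|)·1(U finite)` for a vertex set `U`. [folklore] -/
def finW (n : ℕ) (U : Set (Site d)) : ℝ≥0∞ :=
  if U.Finite then ENNReal.ofReal (wt n (touch (zdGraph d) U).ncard) else 0

/-- `finW` of a finite set. [folklore] -/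
theorem finW_of_finite {n : ℕ} {U : Set (Site d)} (h : U.Finite) :
    finW n U = ENNReal.ofReal (wt n (touch (zdGraph d) U).ncard) := by simp [finW, h]

/-- `finW` of an infinite set is `0`. [folklore] -/
theorem finW_of_infinite {n : ℕ} {U : Set (Site d)} (h : ¬ U.Finite) : finW n U = 0 := by simp [finW, h]

/-- `w(|E(C(x))|)·1(C(x) finite)`. [folklore] -/
def Wf (n : ℕ) (ω : BondConfig (Site d)) (x : Site d) : ℝ≥0∞ := finW n (openCluster ω x)

/-- `W_x` for a finite cluster. [folklore] -/
theorem Wfin_of_finite {n : ℕ} {ω : BondConfig (Site d)} {x : Site d} (h : (openCluster ω x).Finite) :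
    Wfin n ω x = ENNReal.ofReal (wt n (tE ω x)) := by simp [Wfin, h]

/-- `W_x = 1` for an infinite cluster. [folklore] -/
theorem Wfin_of_infinite {n : ℕ} {ω : BondConfig (Site d)} {x : Site d} (h : ¬ (openCluster ω x).Finite) :
    Wfin n ω x = 1 := by simp [Wfin, h]

/-- `Wf` for a finite cluster. [folklore] -/
theorem Wf_of_finite {n : ℕ} {ω : BondConfig (Site d)} {x : Site d} (h : (openCluster ω x).Finite) :
    Wf n ω x = ENNReal.ofReal (wt n (tE ω x)) := finW_of_finite h

/-- `Wf = 0` for an infinite cluster. [folklore] -/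
theorem Wf_of_infinite {n : ℕ} {ω : BondConfig (Site d)} {x : Site d} (h : ¬ (openCluster ω x).Finite) :
    Wf n ω x = 0 := finW_of_infinite h

/-- `Wf ≤ 1`. [folklore] -/
theorem Wf_le_one (n : ℕ) (ω : BondConfig (Site d)) (x : Site d) : Wf n ω x ≤ 1 := by
  by_cases h : (openCluster ω x).Finite
  · rw [Wf_of_finite h]; exact ENNReal.ofReal_le_one.2 (wt_le_one _ _)
  · rw [Wf_of_infinite h]; exact zero_le_one

/-- `W_x ≤ 1`. [folklore] -/
theorem Wfin_le_one (n : ℕ) (ω : BondConfig (Site d)) (x : Site d) : Wfin n ω x ≤ 1 := by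
  by_cases h : (openCluster ω x).Finite
  · rw [Wfin_of_finite h]; exact ENNReal.ofReal_le_one.2 (wt_le_one _ _)
  · rw [Wfin_of_infinite h]

open Classical in
/-- `Wf` is measurable. [folklore] -/
theorem measurable_Wf (n : ℕ) (x : Site d) : Measurable fun ω : BondConfig (Site d) => Wf n ω x := by
  have h : (fun ω : BondConfig (Site d) => Wf n ω x) = fun ω =>
      if (openCluster ω x).Finite then ENNReal.ofReal (wt n (tE ω x)) else 0 := by
    funext ω
    by_cases hf : (openCluster ω x).Finite
    · rw [Wf_of_finite hf, if_pos hf]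
    · rw [Wf_of_infinite hf, if_neg hf]
  rw [h]
  exact measurable_finStats x (c := 0) fun t _ _ _ => ENNReal.ofReal (wt n t)

/-- `W_x` is measurable. [folklore] -/
theorem measurable_Wfin (n : ℕ) (x : Site d) : Measurable fun ω : BondConfig (Site d) => Wfin n ω x :=
  measurable_finStats x (c := 1) fun t _ _ _ => ENNReal.ofReal (wt n t)

/-- The target: `1(e closed)·1(a ↮ b)·1(C(a) or C(b) finite)·W_a·W_b`.
[cite: Hutchcroft2020Locality, §3, proof of Lemma 3.1] -/
def Tgt (n : ℕ) (ℓ : Site d × Fin d) (ω : BondConfig (Site d)) : ℝ≥0∞ :=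
  ind {ω | edgeOf ℓ ∉ ω} ω * ind {ω | headOf ℓ ∉ openCluster ω ℓ.1} ω *
    ind {ω | (openCluster ω ℓ.1).Finite ∨ (openCluster ω (headOf ℓ)).Finite} ω *
    (Wfin n ω ℓ.1 * Wfin n ω (headOf ℓ))

/-- `N^cl_e = 1(e closed)·Σ_{K finite cluster touching e} w(K)`.
[cite: Hutchcroft2020Locality, §3, proof of Lemma 3.1] -/
def Ncl (n : ℕ) (ℓ : Site d × Fin d) (ω : BondConfig (Site d)) : ℝ≥0∞ :=
  ind {ω | edgeOf ℓ ∉ ω} ω * (Wf n ω ℓ.1 + ind {ω | ℓ.1 ∉ openCluster ω (headOf ℓ)} ω * Wf n ω (headOf ℓ))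

/-- `N^op_e = 1(e open)·Σ_{K finite cluster touching e} w(K)` (one cluster when `e` is open).
[cite: Hutchcroft2020Locality, §3, proof of Lemma 3.1] -/
def Nop (n : ℕ) (ℓ : Site d × Fin d) (ω : BondConfig (Site d)) : ℝ≥0∞ :=
  ind {ω | edgeOf ℓ ∈ ω} ω * Wf n ω ℓ.1

/-- `G_e = 1(C(a) ∪ C(b) finite)·w(|E(C(a) ∪ C(b))|)`, which does not depend on `ω(e)`.
[cite: Hutchcroft2020Locality, §3, proof of Lemma 3.1] -/
def Gfl (n : ℕ) (ℓ : Site d × Fin d) (ω : BondConfig (Site d)) : ℝ≥0∞ :=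
  finW n (openCluster ω ℓ.1 ∪ openCluster ω (headOf ℓ))

/-- `finW ≤ 1`. [folklore] -/
theorem finW_le_one (n : ℕ) (U : Set (Site d)) : finW n U ≤ 1 := by
  by_cases h : U.Finite
  · rw [finW_of_finite h]; exact ENNReal.ofReal_le_one.2 (wt_le_one _ _)
  · rw [finW_of_infinite h]; exact zero_le_one

/-- `G_e ≤ 1`. [folklore] -/
theorem Gfl_le_one (n : ℕ) (ℓ : Site d × Fin d) (ω : BondConfig (Site d)) : Gfl n ℓ ω ≤ 1 :=
  finW_le_one n _

/-- **`G_e` does not depend on the state of `e`.**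
[cite: Hutchcroft2020Locality, §3, proof of Lemma 3.1] -/
theorem Gfl_diff (n : ℕ) (ℓ : Site d × Fin d) (ω : BondConfig (Site d)) :
    Gfl n ℓ (ω \ {edgeOf ℓ}) = Gfl n ℓ ω := by
  simp only [Gfl, edgeOf_eq, union_openCluster_diff_eq_self]

/-- When `e` is open, `G_e = w(C(a))·1(C(a) finite)` (there is one cluster at `e`). [folklore] -/
theorem Gfl_of_mem {n : ℕ} {ℓ : Site d × Fin d} {ω : BondConfig (Site d)} (he : edgeOf ℓ ∈ ω) :
    Gfl n ℓ ω = Wf n ω ℓ.1 := by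
  have hK : openCluster ω (headOf ℓ) = openCluster ω ℓ.1 := openCluster_eq_of_mk_mem (headOf_ne ℓ) he
  rw [Gfl, hK, Set.union_self, Wf]

/-- `1(e open)·G_e = N^op_e`. [folklore] -/
theorem ind_mem_mul_Gfl (n : ℕ) (ℓ : Site d × Fin d) (ω : BondConfig (Site d)) :
    ind {ω | edgeOf ℓ ∈ ω} ω * Gfl n ℓ ω = Nop n ℓ ω := by
  by_cases he : edgeOf ℓ ∈ ω
  · rw [Nop, Gfl_of_mem he]
  · rw [Nop, ind_of_notMem (show ω ∉ {ω | edgeOf ℓ ∈ ω} from he), zero_mul, zero_mul]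

/-- **The pointwise AKN inequality** (Hutchcroft 2020, (3.1)–(3.4) with the ghost field
integrated out, in inequality form): `Tgt + 1(e closed)·G_e ≤ N^cl_e`.
[cite: Hutchcroft2020Locality, §3, proof of Lemma 3.1] -/
theorem Tgt_add_le (n : ℕ) (ℓ : Site d × Fin d) (ω : BondConfig (Site d)) :
    Tgt n ℓ ω + ind {ω | edgeOf ℓ ∉ ω} ω * Gfl n ℓ ω ≤ Ncl n ℓ ω := by
  set a := ℓ.1 with ha
  set b := headOf ℓ with hb
  by_cases he : edgeOf ℓ ∈ ω
  · have h0 : ind {ω | edgeOf ℓ ∉ ω} ω = 0 := ind_of_notMem (show ω ∉ {ω | edgeOf ℓ ∉ ω} from fun h => h he)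
    simp only [Tgt, Ncl, h0, zero_mul, zero_add, le_refl]
  have h1 : ind {ω | edgeOf ℓ ∉ ω} ω = 1 := ind_of_mem (show ω ∈ {ω | edgeOf ℓ ∉ ω} from he)
  simp only [Tgt, Ncl, h1, one_mul]
  by_cases hab : b ∈ openCluster ω a
  · -- connected around the closed edge: one cluster
    have hK : openCluster ω b = openCluster ω a := openCluster_eq_of_mem hab
    have hba : a ∈ openCluster ω b := mem_openCluster_comm.1 hab
    rw [ind_of_notMem (show ω ∉ {ω | b ∉ openCluster ω a} from fun h => h hab), zero_mul, zero_mul, zero_add,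
      ind_of_notMem (show ω ∉ {ω | a ∉ openCluster ω b} from fun h => h hba), zero_mul, add_zero]
    have : Gfl n ℓ ω = Wf n ω a := by
      rw [Gfl, ← ha, ← hb, hK, Set.union_self, Wf]
    rw [this]
  · have hba : a ∉ openCluster ω b := fun h => hab (mem_openCluster_comm.1 h)
    rw [ind_of_mem (show ω ∈ {ω | b ∉ openCluster ω a} from hab), one_mul,
      ind_of_mem (show ω ∈ {ω | a ∉ openCluster ω b} from hba), one_mul]
    by_cases hfa : (openCluster ω a).Finite <;> by_cases hfb : (openCluster ω b).Finite
    · -- both finite: the FKG-substitute `w(a)w(b) + w(|E(C(a)) ∪ E(C(b))|) ≤ w(a) + w(b)`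
      have hU : (openCluster ω a ∪ openCluster ω b).Finite := hfa.union hfb
      rw [ind_of_mem (show ω ∈ {ω | (openCluster ω a).Finite ∨ (openCluster ω b).Finite} from Or.inl hfa),
        one_mul, Wfin_of_finite hfa, Wfin_of_finite hfb, Wf_of_finite hfa, Wf_of_finite hfb]
      have hG : Gfl n ℓ ω = ENNReal.ofReal (wt n (touch (zdGraph d) (openCluster ω a ∪ openCluster ω b)).ncard) := by
        rw [Gfl, ← ha, ← hb, finW_of_finite hU]
      rw [hG, ← ENNReal.ofReal_mul (wt_nonneg _ _), ← ENNReal.ofReal_add (mul_nonneg (wt_nonneg _ _) (wt_nonneg _ _))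
        (wt_nonneg _ _), ← ENNReal.ofReal_add (wt_nonneg _ _) (wt_nonneg _ _)]
      refine ENNReal.ofReal_le_ofReal (wt_mul_add_le n ?_)
      rw [touch_union, tE, tE]
      exact Set.ncard_union_le _ _
    · -- `C(a)` finite, `C(b)` infinite
      have hU : ¬ (openCluster ω a ∪ openCluster ω b).Finite := fun h => hfb (h.subset Set.subset_union_right)
      rw [ind_of_mem (show ω ∈ {ω | (openCluster ω a).Finite ∨ (openCluster ω b).Finite} from Or.inl hfa),
        one_mul, Wfin_of_finite hfa, Wfin_of_infinite hfb, Wf_of_finite hfa, Wf_of_infinite hfb]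
      have hG : Gfl n ℓ ω = 0 := by rw [Gfl, ← ha, ← hb, finW_of_infinite hU]
      rw [hG]; simp
    · -- `C(a)` infinite, `C(b)` finite
      have hU : ¬ (openCluster ω a ∪ openCluster ω b).Finite := fun h => hfa (h.subset Set.subset_union_left)
      rw [ind_of_mem (show ω ∈ {ω | (openCluster ω a).Finite ∨ (openCluster ω b).Finite} from Or.inr hfb),
        one_mul, Wfin_of_infinite hfa, Wfin_of_finite hfb, Wf_of_infinite hfa, Wf_of_finite hfb]
      have hG : Gfl n ℓ ω = 0 := by rw [Gfl, ← ha, ← hb, finW_of_infinite hU]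
      rw [hG]; simp
    · -- both infinite
      have hU : ¬ (openCluster ω a ∪ openCluster ω b).Finite := fun h => hfa (h.subset Set.subset_union_left)
      rw [ind_of_notMem (show ω ∉ {ω | (openCluster ω a).Finite ∨ (openCluster ω b).Finite} from
        fun h => h.elim hfa hfb), zero_mul]
      have hG : Gfl n ℓ ω = 0 := by rw [Gfl, ← ha, ← hb, finW_of_infinite hU]
      rw [hG]; simp

/-! #### Measurability of the Step-1 integrands -/

/-- `G_e` is measurable. [folklore] -/
theorem measurable_Gfl (n : ℕ) (ℓ : Site d × Fin d) : Measurable (Gfl (d := d) n ℓ) := by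
  classical
  let Φ : CData (Site d) → CData (Site d) → ℝ≥0∞ := fun ca cb => match ca, cb with
    | ⟨some (Sa, _)⟩, ⟨some (Sb, _)⟩ => ENNReal.ofReal (wt n (edgesTouching (zdGraph d) (Sa ∪ Sb)).card)
    | _, _ => 0
  have h : Gfl n ℓ = fun ω => Φ (cdata (zdGraph d) ω ℓ.1) (cdata (zdGraph d) ω (headOf ℓ)) := by
    funext ω
    by_cases hfa : (openCluster ω ℓ.1).Finite <;> by_cases hfb : (openCluster ω (headOf ℓ)).Finite
    · rw [cdata_eq_of_finite (hfa.coe_toFinset).symm, cdata_eq_of_finite (hfb.coe_toFinset).symm]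
      simp only [Gfl, finW_of_finite (hfa.union hfb), Φ]
      congr 2
      rw [← Set.ncard_coe_finset, ← touch_coe_eq, Finset.coe_union, hfa.coe_toFinset, hfb.coe_toFinset]
    · rw [cdata_of_infinite hfb]
      have hU : ¬ (openCluster ω ℓ.1 ∪ openCluster ω (headOf ℓ)).Finite := fun h => hfb (h.subset Set.subset_union_right)
      simp only [Gfl, finW_of_infinite hU, Φ]
      rcases cdata (zdGraph d) ω ℓ.1 with ⟨_ | ⟨_, _⟩⟩ <;> rfl
    · rw [cdata_of_infinite hfa]
      have hU : ¬ (openCluster ω ℓ.1 ∪ openCluster ω (headOf ℓ)).Finite := fun h => hfa (h.subset Set.subset_union_left)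
      simp only [Gfl, finW_of_infinite hU, Φ]
    · rw [cdata_of_infinite hfa]
      have hU : ¬ (openCluster ω ℓ.1 ∪ openCluster ω (headOf ℓ)).Finite := fun h => hfa (h.subset Set.subset_union_left)
      simp only [Gfl, finW_of_infinite hU, Φ]
  rw [h]
  exact measurable_comp_cdata₂ ℓ.1 (headOf ℓ) Φ

/-- The target is measurable. [folklore] -/
theorem measurable_Tgt (n : ℕ) (ℓ : Site d × Fin d) : Measurable (Tgt (d := d) n ℓ) := by
  unfold Tgt
  refine ((((measurable_ind (measurableSet_notMem _)).mul
    (measurable_ind (measurableSet_mem_openCluster _ _).compl)).mul (measurable_ind ?_)).mul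
    ((measurable_Wfin n _).mul (measurable_Wfin n _)))
  exact (measurableSet_finite_openCluster _).union (measurableSet_finite_openCluster _)

/-- `N^cl_e` is measurable. [folklore] -/
theorem measurable_Ncl (n : ℕ) (ℓ : Site d × Fin d) : Measurable (Ncl (d := d) n ℓ) := by
  unfold Ncl
  exact (measurable_ind (measurableSet_notMem _)).mul
    ((measurable_Wf n _).add ((measurable_ind (measurableSet_mem_openCluster _ _).compl).mul (measurable_Wf n _)))

/-- `N^op_e` is measurable. [folklore] -/
theorem measurable_Nop (n : ℕ) (ℓ : Site d × Fin d) : Measurable (Nop (d := d) n ℓ) := by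
  unfold Nop
  exact (measurable_ind (measurableSet_mem _)).mul (measurable_Wf n _)

/-- **Step 1** (Hutchcroft 2020, Lemma 3.1 up to the mass transport, eq. (3.4) in inequality
form): `E[Tgt_e] + ((1-p)/p)·E[N^op_e] ≤ E[N^cl_e]`.
[cite: Hutchcroft2020Locality, §3, proof of Lemma 3.1] -/
theorem lintegral_Tgt_add_le (n : ℕ) (p : unitInterval) (hp : 0 < (p : ℝ)) (ℓ : Site d × Fin d) :
    ∫⁻ ω, Tgt n ℓ ω ∂(bondPercolation (zdGraph d) p) +
        ENNReal.ofReal ((1 - p) / p) * ∫⁻ ω, Nop n ℓ ω ∂(bondPercolation (zdGraph d) p) ≤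
      ∫⁻ ω, Ncl n ℓ ω ∂(bondPercolation (zdGraph d) p) := by
  set P := bondPercolation (zdGraph d) p with hP
  have hG := measurable_Gfl (d := d) n ℓ
  have hGfin : ∫⁻ ω, Gfl n ℓ ω ∂P ≠ ∞ := by
    refine ne_top_of_le_ne_top ENNReal.one_ne_top ?_
    calc ∫⁻ ω, Gfl n ℓ ω ∂P ≤ ∫⁻ _, 1 ∂P := lintegral_mono fun ω => Gfl_le_one n ℓ ω
      _ = 1 := by rw [lintegral_const, measure_univ, mul_one]
  -- `E[1(e closed) G] = (1-p) E[G]` and `E[N^op] = E[1(e open) G] = p E[G]`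
  have hcl : ∫⁻ ω, ind {ω | edgeOf ℓ ∉ ω} ω * Gfl n ℓ ω ∂P = ENNReal.ofReal (1 - p) * ∫⁻ ω, Gfl n ℓ ω ∂P :=
    lintegral_notMem_mul_of_flip p (edgeOf_mem_edgeSet ℓ) hG (Gfl_diff n ℓ) hGfin
  have hop : ∫⁻ ω, Nop n ℓ ω ∂P = ENNReal.ofReal p * ∫⁻ ω, Gfl n ℓ ω ∂P := by
    rw [← lintegral_mem_mul_of_flip p (edgeOf_mem_edgeSet ℓ) hG (Gfl_diff n ℓ)]
    exact lintegral_congr fun ω => (ind_mem_mul_Gfl n ℓ ω).symm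
  have hq : ENNReal.ofReal ((1 - p) / p) * ∫⁻ ω, Nop n ℓ ω ∂P = ∫⁻ ω, ind {ω | edgeOf ℓ ∉ ω} ω * Gfl n ℓ ω ∂P := by
    rw [hcl, hop, ← mul_assoc, ← ENNReal.ofReal_mul (div_nonneg (sub_nonneg.2 p.2.2) hp.le),
      div_mul_cancel₀ _ hp.ne']
  rw [hq, ← lintegral_add_left (measurable_Tgt n ℓ)]
  exact lintegral_mono fun ω => Tgt_add_le n ℓ ω

/-! ### Step 2. Mass transport (Hutchcroft 2020, proof of Lemma 3.1, (3.5)–(3.6))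

Each edge `e` of state `s` sends to every vertex `v` of every FINITE cluster `K` touching `e` the
mass `w(K)/|K|`; the total mass sent by `e` is `1(state e = s)·Σ_{K finite touching e} w(K)`, the
mass received by `x` is `1(C(x) finite)·(w(C(x))/|C(x)|)·#{edges of state s touching C(x)}`. -/

/-- The state event of the edge with label `ℓ`: open (`s = true`) or closed (`s = false`).
[folklore] -/
def stEv (s : Bool) (ℓ : Site d × Fin d) : Set (BondConfig (Site d)) :=
  if s then {ω | edgeOf ℓ ∈ ω} else {ω | edgeOf ℓ ∉ ω}

/-- The open-state event. [folklore] -/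
theorem stEv_true (ℓ : Site d × Fin d) : stEv true ℓ = {ω | edgeOf ℓ ∈ ω} := rfl

/-- The closed-state event. [folklore] -/
theorem stEv_false (ℓ : Site d × Fin d) : stEv false ℓ = {ω | edgeOf ℓ ∉ ω} := rfl

/-- State events are measurable. [folklore] -/
theorem measurableSet_stEv (s : Bool) (ℓ : Site d × Fin d) : MeasurableSet (stEv s ℓ) := by
  cases s
  · exact measurableSet_notMem _
  · exact measurableSet_mem _

/-- State events are translation covariant. [folklore] -/
theorem shiftConfig_mem_stEv_iff (s : Bool) (u : Site d) (ℓ : Site d × Fin d) (ω : BondConfig (Site d)) :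
    shiftConfig u ω ∈ stEv s (labelShift u ℓ) ↔ ω ∈ stEv s ℓ := by
  cases s
  · simp only [stEv_false, Set.mem_setOf_eq, labelShift_apply, edgeOf_shift_mem_iff]
  · simp only [stEv_true, Set.mem_setOf_eq, labelShift_apply, edgeOf_shift_mem_iff]

open Classical in
/-- The mass density of a vertex of a finite cluster: `w(|E(C(v))|)/|C(v)|` (`0` if infinite).
[cite: Hutchcroft2020Locality, §3, proof of Lemma 3.1] -/
def Vw (n : ℕ) (ω : BondConfig (Site d)) (v : Site d) : ℝ≥0∞ :=
  if (openCluster ω v).Finite then ENNReal.ofReal (wt n (tE ω v)) / (nK ω v : ℝ≥0∞) else 0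

/-- The vertex density of a finite cluster. [folklore] -/
theorem Vw_of_finite {n : ℕ} {ω : BondConfig (Site d)} {v : Site d} (h : (openCluster ω v).Finite) :
    Vw n ω v = ENNReal.ofReal (wt n (tE ω v)) / (nK ω v : ℝ≥0∞) := by simp [Vw, h]

/-- The vertex density of an infinite cluster is `0`. [folklore] -/
theorem Vw_of_infinite {n : ℕ} {ω : BondConfig (Site d)} {v : Site d} (h : ¬ (openCluster ω v).Finite) :
    Vw n ω v = 0 := by simp [Vw, h]

open Classical in
/-- The vertex density is measurable. [folklore] -/
theorem measurable_Vw (n : ℕ) (v : Site d) : Measurable fun ω : BondConfig (Site d) => Vw n ω v :=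
  measurable_finStats v (c := 0) fun t _ _ k => ENNReal.ofReal (wt n t) / (k : ℝ≥0∞)

/-- The vertex density is translation invariant. [folklore] -/
theorem Vw_shift (n : ℕ) (u : Site d) (ω : BondConfig (Site d)) (v : Site d) :
    Vw n (shiftConfig u ω) (v + u) = Vw n ω v := by
  by_cases h : (openCluster ω v).Finite
  · rw [Vw_of_finite h, Vw_of_finite ((finite_openCluster_shiftConfig_iff u ω v).2 h), tE_shift, nK_shift]
  · rw [Vw_of_infinite h, Vw_of_infinite (fun h' => h ((finite_openCluster_shiftConfig_iff u ω v).1 h'))]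

/-- The transport `g_s(ℓ, v)`: mass sent by the edge `ℓ` (if in state `s`) to the vertex `v`.
[cite: Hutchcroft2020Locality, §3, proof of Lemma 3.1] -/
def gtr (s : Bool) (n : ℕ) (ℓ : Site d × Fin d) (v : Site d) (ω : BondConfig (Site d)) : ℝ≥0∞ :=
  ind (stEv s ℓ) ω * (ind {ω | ℓ.1 ∈ openCluster ω v ∨ headOf ℓ ∈ openCluster ω v} ω * Vw n ω v)

/-- The transport is measurable in the configuration. [folklore] -/
theorem measurable_gtr (s : Bool) (n : ℕ) (ℓ : Site d × Fin d) (v : Site d) : Measurable (gtr (d := d) s n ℓ v) := by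
  unfold gtr
  exact (measurable_ind (measurableSet_stEv s ℓ)).mul
    ((measurable_ind ((measurableSet_mem_openCluster _ _).union (measurableSet_mem_openCluster _ _))).mul
      (measurable_Vw n v))

/-- **Diagonal invariance of the transport** under translations.
[cite: Hutchcroft2020Locality, §3, proof of Lemma 3.1] -/
theorem gtr_shift (s : Bool) (n : ℕ) (u : Site d) (ℓ : Site d × Fin d) (v : Site d) (ω : BondConfig (Site d)) :
    gtr s n (labelShift u ℓ) (v + u) (shiftConfig u ω) = gtr s n ℓ v ω := by
  unfold gtr
  have h1 : ind (stEv s (labelShift u ℓ)) (shiftConfig u ω) = ind (stEv s ℓ) ω := by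
    by_cases h : ω ∈ stEv s ℓ
    · rw [ind_of_mem h, ind_of_mem ((shiftConfig_mem_stEv_iff s u ℓ ω).2 h)]
    · rw [ind_of_notMem h, ind_of_notMem (fun h' => h ((shiftConfig_mem_stEv_iff s u ℓ ω).1 h'))]
  have hhead : headOf (labelShift u ℓ) = headOf ℓ + u := by
    simp only [headOf, labelShift_apply, add_right_comm]
  have h2 : ind {ω' | (labelShift u ℓ).1 ∈ openCluster ω' (v + u) ∨ headOf (labelShift u ℓ) ∈ openCluster ω' (v + u)}
      (shiftConfig u ω) = ind {ω | ℓ.1 ∈ openCluster ω v ∨ headOf ℓ ∈ openCluster ω v} ω := by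
    have hiff : (shiftConfig u ω ∈ {ω' | (labelShift u ℓ).1 ∈ openCluster ω' (v + u) ∨
        headOf (labelShift u ℓ) ∈ openCluster ω' (v + u)}) ↔
        ω ∈ {ω | ℓ.1 ∈ openCluster ω v ∨ headOf ℓ ∈ openCluster ω v} := by
      simp only [Set.mem_setOf_eq, hhead]
      simp only [labelShift_apply, add_mem_openCluster_shiftConfig_iff]
    by_cases h : ω ∈ {ω | ℓ.1 ∈ openCluster ω v ∨ headOf ℓ ∈ openCluster ω v}
    · rw [ind_of_mem h, ind_of_mem (hiff.2 h)]
    · rw [ind_of_notMem h, ind_of_notMem (fun h' => h (hiff.1 h'))]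
  rw [h1, h2, Vw_shift]

/-- The weighted count of finite clusters touching the edge `ℓ = {a, b}`:
`w(C(a))1(C(a) finite) + 1(a ∉ C(b)) w(C(b)) 1(C(b) finite)`.
[cite: Hutchcroft2020Locality, §3, proof of Lemma 3.1] -/
def NN (n : ℕ) (ℓ : Site d × Fin d) (ω : BondConfig (Site d)) : ℝ≥0∞ :=
  Wf n ω ℓ.1 + ind {ω | ℓ.1 ∉ openCluster ω (headOf ℓ)} ω * Wf n ω (headOf ℓ)

/-- `N^cl_e = 1(e closed)·NN_e`. [folklore] -/
theorem Ncl_eq (n : ℕ) (ℓ : Site d × Fin d) (ω : BondConfig (Site d)) :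
    Ncl n ℓ ω = ind (stEv false ℓ) ω * NN n ℓ ω := rfl

/-- `N^op_e = 1(e open)·NN_e` (when `e` is open there is only one cluster at `e`). [folklore] -/
theorem Nop_eq (n : ℕ) (ℓ : Site d × Fin d) (ω : BondConfig (Site d)) :
    Nop n ℓ ω = ind (stEv true ℓ) ω * NN n ℓ ω := by
  rw [Nop, stEv_true, NN]
  by_cases he : edgeOf ℓ ∈ ω
  · have hK : openCluster ω (headOf ℓ) = openCluster ω ℓ.1 := openCluster_eq_of_mk_mem (headOf_ne ℓ) he
    rw [ind_of_notMem (show ω ∉ {ω | ℓ.1 ∉ openCluster ω (headOf ℓ)} from fun h => h (hK ▸ mem_openCluster_self ω ℓ.1)),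
      zero_mul, add_zero]
  · rw [ind_of_notMem (show ω ∉ {ω | edgeOf ℓ ∈ ω} from he), zero_mul, zero_mul]

/-- Summing the vertex densities over a cluster gives its weight:
`Σ_v 1(v ∈ C(x)) w(C(v))/|C(v)| 1(C(v) finite) = w(C(x)) 1(C(x) finite)`.
[cite: Hutchcroft2020Locality, §3, proof of Lemma 3.1] -/
theorem tsum_ind_mem_mul_Vw (n : ℕ) (ω : BondConfig (Site d)) (x : Site d) :
    ∑' v, ind {ω | v ∈ openCluster ω x} ω * Vw n ω v = Wf n ω x := by
  by_cases hf : (openCluster ω x).Finite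
  · have hconst : ∀ v ∈ hf.toFinset, ind {ω | v ∈ openCluster ω x} ω * Vw n ω v =
        ENNReal.ofReal (wt n (tE ω x)) / (nK ω x : ℝ≥0∞) := by
      intro v hv
      rw [Set.Finite.mem_toFinset] at hv
      have hK : openCluster ω v = openCluster ω x := openCluster_eq_of_mem hv
      rw [ind_of_mem (show ω ∈ {ω | v ∈ openCluster ω x} from hv), one_mul, Vw_of_finite (hK ▸ hf), tE, nK, hK, tE, nK]
    rw [tsum_eq_sum (s := hf.toFinset) (L := SummationFilter.unconditional _), Finset.sum_congr rfl hconst,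
      Finset.sum_const, nsmul_eq_mul, Wf_of_finite hf]
    · have hk : (hf.toFinset.card : ℝ≥0∞) = (nK ω x : ℝ≥0∞) := by
        rw [nK, Set.ncard_eq_toFinset_card _ hf]
      rw [hk]
      refine ENNReal.mul_div_cancel ?_ (ENNReal.natCast_ne_top _)
      have : 1 ≤ nK ω x := by
        rw [nK, Nat.one_le_iff_ne_zero, Ne, Set.ncard_eq_zero hf]
        exact fun h => by simpa [h] using mem_openCluster_self ω x
      exact_mod_cast Nat.one_le_iff_ne_zero.1 this
    · intro v hv
      rw [Set.Finite.mem_toFinset] at hv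
      rw [ind_of_notMem (show ω ∉ {ω | v ∈ openCluster ω x} from hv), zero_mul]
  · rw [Wf_of_infinite hf]
    refine ENNReal.tsum_eq_zero.2 fun v => ?_
    by_cases hv : v ∈ openCluster ω x
    · have hK : openCluster ω v = openCluster ω x := openCluster_eq_of_mem hv
      rw [Vw_of_infinite (hK ▸ hf), mul_zero]
    · rw [ind_of_notMem (show ω ∉ {ω | v ∈ openCluster ω x} from hv), zero_mul]

/-- **Out-mass of an edge**: `Σ_v g_s(ℓ, v) = 1(state = s)·NN_ℓ`.
[cite: Hutchcroft2020Locality, §3, proof of Lemma 3.1] -/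
theorem tsum_gtr_eq (s : Bool) (n : ℕ) (ℓ : Site d × Fin d) (ω : BondConfig (Site d)) :
    ∑' v, gtr s n ℓ v ω = ind (stEv s ℓ) ω * NN n ℓ ω := by
  simp only [gtr]
  rw [ENNReal.tsum_mul_left]
  congr 1
  set a := ℓ.1
  set b := headOf ℓ
  -- split the indicator of `{a ∈ C(v)} ∪ {b ∈ C(v)} = {v ∈ C(a)} ∪ ({v ∈ C(b)} ∖ {v ∈ C(a)})`
  have hsplit : ∀ v, ind {ω | a ∈ openCluster ω v ∨ b ∈ openCluster ω v} ω * Vw n ω v =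
      ind {ω | v ∈ openCluster ω a} ω * Vw n ω v +
        ind {ω | a ∉ openCluster ω b} ω * (ind {ω | v ∈ openCluster ω b} ω * Vw n ω v) := by
    intro v
    by_cases hva : v ∈ openCluster ω a
    · have h1 : ω ∈ {ω | a ∈ openCluster ω v ∨ b ∈ openCluster ω v} := Or.inl (mem_openCluster_comm.1 hva)
      rw [ind_of_mem h1, ind_of_mem (show ω ∈ {ω | v ∈ openCluster ω a} from hva), one_mul]
      by_cases hab : a ∈ openCluster ω b
      · rw [ind_of_notMem (show ω ∉ {ω | a ∉ openCluster ω b} from fun h => h hab), zero_mul, add_zero]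
      · have hvb : v ∉ openCluster ω b := fun hvb =>
          hab (SimpleGraph.Reachable.trans hvb (SimpleGraph.Reachable.symm hva))
        rw [ind_of_notMem (show ω ∉ {ω | v ∈ openCluster ω b} from hvb), zero_mul, mul_zero, add_zero]
    · rw [ind_of_notMem (show ω ∉ {ω | v ∈ openCluster ω a} from hva), zero_mul, zero_add]
      by_cases hvb : v ∈ openCluster ω b
      · have h1 : ω ∈ {ω | a ∈ openCluster ω v ∨ b ∈ openCluster ω v} := Or.inr (mem_openCluster_comm.1 hvb)
        have hab : a ∉ openCluster ω b := fun hab =>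
          hva (by
            have hKb : openCluster ω a = openCluster ω b := openCluster_eq_of_mem hab
            rw [hKb]; exact hvb)
        rw [ind_of_mem h1, ind_of_mem (show ω ∈ {ω | a ∉ openCluster ω b} from hab),
          ind_of_mem (show ω ∈ {ω | v ∈ openCluster ω b} from hvb), one_mul, one_mul]
      · have h1 : ω ∉ {ω | a ∈ openCluster ω v ∨ b ∈ openCluster ω v} := fun h =>
          h.elim (fun h => hva (mem_openCluster_comm.1 h)) (fun h => hvb (mem_openCluster_comm.1 h))
        rw [ind_of_notMem h1, ind_of_notMem (show ω ∉ {ω | v ∈ openCluster ω b} from hvb)]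
        simp
  simp_rw [hsplit]
  rw [ENNReal.tsum_add, ENNReal.tsum_mul_left, tsum_ind_mem_mul_Vw, tsum_ind_mem_mul_Vw, NN]

/-- The number of edges of state `s` touching `C(x)`: `|E_∘(K)|` (`s = true`) or `|∂K|`.
[folklore] -/
def nEv (s : Bool) (ω : BondConfig (Site d)) (x : Site d) : ℕ := if s then nOp ω x else nCl ω x

/-- The edges of state `s` touching `C(x)`. [folklore] -/
def edgesSt (s : Bool) (ω : BondConfig (Site d)) (x : Site d) : Set (Sym2 (Site d)) :=
  {e ∈ touch (zdGraph d) (openCluster ω x) | (e ∈ ω ↔ s = true)}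

/-- The number of edges of state `s` touching `C(x)`. [folklore] -/
theorem ncard_edgesSt (s : Bool) (ω : BondConfig (Site d)) (x : Site d) : (edgesSt s ω x).ncard = nEv s ω x := by
  cases s
  · simp only [edgesSt, nEv, nCl, Bool.false_eq_true, iff_false]
    rfl
  · simp only [edgesSt, nEv, nOp, iff_true]
    rfl

/-- Edges of state `s` touching `C(x)` touch `C(x)`. [folklore] -/
theorem edgesSt_subset (s : Bool) (ω : BondConfig (Site d)) (x : Site d) :
    edgesSt s ω x ⊆ touch (zdGraph d) (openCluster ω x) := fun _ h => h.1

/-- Membership in the state event. [folklore] -/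
theorem mem_stEv_iff (s : Bool) (ℓ : Site d × Fin d) (ω : BondConfig (Site d)) :
    ω ∈ stEv s ℓ ↔ (edgeOf ℓ ∈ ω ↔ s = true) := by
  cases s <;> simp [stEv]

open Classical in
/-- The two indicators in `g_s(ℓ, x)` single out the labels of the edges of state `s` touching `C(x)`.
[folklore] -/
theorem ind_stEv_mul_ind_eq (s : Bool) (ℓ : Site d × Fin d) (x : Site d) (ω : BondConfig (Site d)) :
    ind (stEv s ℓ) ω * ind {ω | ℓ.1 ∈ openCluster ω x ∨ headOf ℓ ∈ openCluster ω x} ω =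
      if edgeOf ℓ ∈ edgesSt s ω x then 1 else 0 := by
  have hiff : edgeOf ℓ ∈ edgesSt s ω x ↔
      ω ∈ stEv s ℓ ∧ ω ∈ {ω | ℓ.1 ∈ openCluster ω x ∨ headOf ℓ ∈ openCluster ω x} := by
    rw [edgesSt, Set.mem_setOf_eq, edgeOf_mem_touch_iff, mem_stEv_iff, and_comm]
    rfl
  by_cases h1 : ω ∈ stEv s ℓ <;> by_cases h2 : ω ∈ {ω | ℓ.1 ∈ openCluster ω x ∨ headOf ℓ ∈ openCluster ω x}
  · rw [ind_of_mem h1, ind_of_mem h2, if_pos (hiff.2 ⟨h1, h2⟩), one_mul]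
  · rw [ind_of_notMem h2, mul_zero, if_neg (fun h => h2 (hiff.1 h).2)]
  · rw [ind_of_notMem h1, zero_mul, if_neg (fun h => h1 (hiff.1 h).1)]
  · rw [ind_of_notMem h1, zero_mul, if_neg (fun h => h1 (hiff.1 h).1)]

open Classical in
/-- **In-mass of a vertex**: `Σ_ℓ g_s(ℓ, x) = (w(C(x))/|C(x)|)·1(C(x) finite)·#{edges of state s touching C(x)}`.
[cite: Hutchcroft2020Locality, §3, proof of Lemma 3.1] -/
theorem tsum_gtr_self (s : Bool) (n : ℕ) (x : Site d) (ω : BondConfig (Site d)) :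
    ∑' ℓ, gtr s n ℓ x ω = Vw n ω x * (nEv s ω x : ℝ≥0∞) := by
  have hterm : ∀ ℓ, gtr s n ℓ x ω = (if edgeOf ℓ ∈ edgesSt s ω x then 1 else 0) * Vw n ω x := by
    intro ℓ; rw [gtr, ← mul_assoc, ind_stEv_mul_ind_eq]
  simp_rw [hterm]
  by_cases hf : (openCluster ω x).Finite
  · have hF : {ℓ : Site d × Fin d | edgeOf ℓ ∈ edgesSt s ω x}.Finite :=
      finite_setOf_edgeOf_mem ((touch_finite hf).subset (edgesSt_subset s ω x))
    rw [tsum_eq_sum (s := hF.toFinset) (L := SummationFilter.unconditional _)]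
    · rw [Finset.sum_congr rfl (g := fun _ => Vw n ω x), Finset.sum_const, nsmul_eq_mul, mul_comm]
      · congr 1
        rw [← ncard_edgesSt, ← ncard_setOf_edgeOf_mem ((edgesSt_subset s ω x).trans (touch_subset_edgeSet _)),
          Set.ncard_eq_toFinset_card _ hF]
      · intro ℓ hℓ
        rw [Set.Finite.mem_toFinset, Set.mem_setOf_eq] at hℓ
        rw [if_pos hℓ, one_mul]
    · intro ℓ hℓ
      rw [Set.Finite.mem_toFinset, Set.mem_setOf_eq] at hℓ
      rw [if_neg hℓ, zero_mul]
  · rw [Vw_of_infinite hf, zero_mul]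
    exact ENNReal.tsum_eq_zero.2 fun ℓ => by rw [mul_zero]

/-- **Step 2** (mass transport, Hutchcroft 2020 (3.5)–(3.6) specialised to `ℤ^d` with the ghost
field integrated out): summed over the `2d` edges `e ∋ x`,
`Σ_{e ∋ x} E[1(state e = s)·NN_e] = 2·E[(w(C(x))/|C(x)|) 1(C(x) finite) #{edges of state s touching C(x)}]`.
[cite: Hutchcroft2020Locality, §3, proof of Lemma 3.1] -/
theorem sum_lintegral_NN_eq (s : Bool) (n : ℕ) (p : unitInterval) (x : Site d) :
    ∑ i : Fin d, (∫⁻ ω, ind (stEv s (x, i)) ω * NN n (x, i) ω ∂(bondPercolation (zdGraph d) p) +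
        ∫⁻ ω, ind (stEv s (x - Pi.single i 1, i)) ω * NN n (x - Pi.single i 1, i) ω ∂(bondPercolation (zdGraph d) p)) =
      2 * ∫⁻ ω, Vw n ω x * (nEv s ω x : ℝ≥0∞) ∂(bondPercolation (zdGraph d) p) := by
  set P := bondPercolation (zdGraph d) p with hP
  set Γ : Site d × Fin d → Site d → ℝ≥0∞ := fun ℓ v => ∫⁻ ω, gtr s n ℓ v ω ∂P with hΓdef
  have hΓ : ∀ (u : Site d) (ℓ : Site d × Fin d) (v : Site d), Γ (labelShift u ℓ) (v + u) = Γ ℓ v := by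
    intro u ℓ v
    simp only [hΓdef]
    rw [← lintegral_shiftConfig u p (gtr s n (labelShift u ℓ) (v + u))]
    exact lintegral_congr fun ω => gtr_shift s n u ℓ v ω
  have hmtp := edge_vertex_mass_transport Γ hΓ x
  have hout : ∀ ℓ : Site d × Fin d, ∑' v, Γ ℓ v = ∫⁻ ω, ind (stEv s ℓ) ω * NN n ℓ ω ∂P := by
    intro ℓ
    simp only [hΓdef]
    rw [← lintegral_tsum fun v => (measurable_gtr s n ℓ v).aemeasurable]
    exact lintegral_congr fun ω => tsum_gtr_eq s n ℓ ω
  have hin : ∑' ℓ, Γ ℓ x = ∫⁻ ω, Vw n ω x * (nEv s ω x : ℝ≥0∞) ∂P := by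
    simp only [hΓdef]
    rw [← lintegral_tsum fun ℓ => (measurable_gtr s n ℓ x).aemeasurable]
    exact lintegral_congr fun ω => tsum_gtr_self s n x ω
  simp_rw [ENNReal.tsum_add, hout] at hmtp
  rw [hmtp, hin]

/-! ### Step 3. From the transport identity to `|h_p|` (Hutchcroft 2020, end of proof of Lemma 3.1)

`N^cl - ((1-p)/p) N^op` transports to `(w(K)/|K|)(|∂K| - ((1-p)/p)|E_∘(K)|) = (w(K)/|K|) h_p(K)/p`,
bounded by `(w(K)/|K|)|h_p(K)|/p`. -/

/-- The vertex density times `|h_p|`: `1(C(x) finite)·(w(C(x))/|C(x)|)·|h_p(C(x))|`.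
[cite: Hutchcroft2020Locality, §3, proof of Lemma 3.1] -/
def Mabs (n : ℕ) (p : ℝ) (ω : BondConfig (Site d)) (x : Site d) : ℝ≥0∞ :=
  Vw n ω x * ENNReal.ofReal |hp p ω x|

open Classical in
/-- The vertex density vanishes on infinite clusters. [folklore] -/
theorem Vw_mul_eq_ite (n : ℕ) (ω : BondConfig (Site d)) (x : Site d) (y : ℝ≥0∞) :
    Vw n ω x * y = if (openCluster ω x).Finite then ENNReal.ofReal (wt n (tE ω x)) / (nK ω x : ℝ≥0∞) * y else 0 := by
  by_cases h : (openCluster ω x).Finite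
  · rw [Vw_of_finite h, if_pos h]
  · rw [Vw_of_infinite h, if_neg h, zero_mul]

open Classical in
/-- The in-mass integrand is measurable. [folklore] -/
theorem measurable_Vw_mul_nEv (s : Bool) (n : ℕ) (x : Site d) :
    Measurable fun ω : BondConfig (Site d) => Vw n ω x * (nEv s ω x : ℝ≥0∞) := by
  have h := measurable_finStats (d := d) x (c := (0 : ℝ≥0∞))
    (fun t nop ncl k => ENNReal.ofReal (wt n t) / (k : ℝ≥0∞) * ((if s then nop else ncl : ℕ) : ℝ≥0∞))
  convert h using 2 with ω
  rw [Vw_mul_eq_ite]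
  rfl

open Classical in
/-- `Mabs` is measurable. [folklore] -/
theorem measurable_Mabs (n : ℕ) (p : ℝ) (x : Site d) : Measurable fun ω : BondConfig (Site d) => Mabs n p ω x := by
  have h := measurable_finStats (d := d) x (c := (0 : ℝ≥0∞))
    (fun t nop ncl k => ENNReal.ofReal (wt n t) / (k : ℝ≥0∞) * ENNReal.ofReal |p * ncl - (1 - p) * nop|)
  convert h using 2 with ω
  rw [Mabs, Vw_mul_eq_ite]
  rfl

/-- `|∂K| ≤ ((1-p)/p)|E_∘(K)| + |h_p(K)|/p`, multiplied by the vertex density.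
[cite: Hutchcroft2020Locality, §3, proof of Lemma 3.1] -/
theorem Vw_mul_nEv_false_le (n : ℕ) {p : ℝ} (hp0 : 0 < p) (hp1 : p ≤ 1) (ω : BondConfig (Site d)) (x : Site d) :
    Vw n ω x * (nEv false ω x : ℝ≥0∞) ≤
      ENNReal.ofReal ((1 - p) / p) * (Vw n ω x * (nEv true ω x : ℝ≥0∞)) + ENNReal.ofReal (1 / p) * Mabs n p ω x := by
  rw [Mabs, mul_left_comm, mul_left_comm (ENNReal.ofReal (1 / p)), ← mul_add]
  gcongr
  simp only [nEv, if_false, if_true, Bool.false_eq_true]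
  have hq : 0 ≤ (1 - p) / p := div_nonneg (by linarith) hp0.le
  rw [← ENNReal.ofReal_natCast, ← ENNReal.ofReal_natCast, ← ENNReal.ofReal_mul hq,
    ← ENNReal.ofReal_mul (by positivity), ← ENNReal.ofReal_add (mul_nonneg hq (Nat.cast_nonneg _))
    (mul_nonneg (by positivity) (abs_nonneg _))]
  refine ENNReal.ofReal_le_ofReal ?_
  rw [hp]
  have h1 : (nCl ω x : ℝ) - (1 - p) / p * nOp ω x = 1 / p * (p * nCl ω x - (1 - p) * nOp ω x) := by
    field_simp
  have h2 : 1 / p * (p * nCl ω x - (1 - p) * nOp ω x) ≤ 1 / p * |p * nCl ω x - (1 - p) * nOp ω x| :=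
    mul_le_mul_of_nonneg_left (le_abs_self _) (by positivity)
  linarith

/-- The `N^op`-mass is finite: `(w(K)/|K|)|E_∘(K)| ≤ |E(K)|/|K| ≤ 2d`. [folklore] -/
theorem Vw_mul_nEv_le (s : Bool) (n : ℕ) (ω : BondConfig (Site d)) (x : Site d) :
    Vw n ω x * (nEv s ω x : ℝ≥0∞) ≤ 2 * d := by
  by_cases hf : (openCluster ω x).Finite
  · rw [Vw_of_finite hf]
    have hk : 1 ≤ nK ω x := by
      rw [nK, Nat.one_le_iff_ne_zero, Ne, Set.ncard_eq_zero hf]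
      exact fun h => by simpa [h] using mem_openCluster_self ω x
    have hle : nEv s ω x ≤ 2 * d * nK ω x := by
      have h1 : nEv s ω x ≤ tE ω x := by
        have := nOp_add_nCl (ω := ω) (x := x) hf
        cases s <;> simp [nEv] <;> omega
      exact h1.trans (by rw [tE, nK]; exact ncard_touch_le hf)
    calc ENNReal.ofReal (wt n (tE ω x)) / (nK ω x : ℝ≥0∞) * (nEv s ω x : ℝ≥0∞)
        ≤ 1 / (nK ω x : ℝ≥0∞) * ((2 * d * nK ω x : ℕ) : ℝ≥0∞) := by
          refine mul_le_mul' ?_ (by exact_mod_cast hle)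
          exact ENNReal.div_le_div_right (ENNReal.ofReal_le_one.2 (wt_le_one _ _)) _
      _ = 2 * d := by
          have hk0 : (nK ω x : ℝ≥0∞) ≠ 0 := by exact_mod_cast (show nK ω x ≠ 0 by omega)
          push_cast
          rw [one_div, mul_comm, mul_assoc, ENNReal.mul_inv_cancel hk0 (ENNReal.natCast_ne_top _), mul_one]
  · rw [Vw_of_infinite hf, zero_mul]; exact bot_le

/-- **Steps 1–3 combined** (Hutchcroft 2020, Lemma 3.1 and (3.2), on `ℤ^d`, ghost-free):
`Σ_{e ∋ x} E[Tgt_e] ≤ (2/p)·E[1(C(x) finite) w(C(x)) |h_p(C(x))| / |C(x)|]`.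
[cite: Hutchcroft2020Locality, §3, proof of Lemma 3.1] -/
theorem sum_lintegral_Tgt_le (n : ℕ) (p : unitInterval) (hp : 0 < (p : ℝ)) (x : Site d) :
    ∑ i : Fin d, (∫⁻ ω, Tgt n (x, i) ω ∂(bondPercolation (zdGraph d) p) +
        ∫⁻ ω, Tgt n (x - Pi.single i 1, i) ω ∂(bondPercolation (zdGraph d) p)) ≤
      2 * ENNReal.ofReal (1 / p) * ∫⁻ ω, Mabs n p ω x ∂(bondPercolation (zdGraph d) p) := by
  set P := bondPercolation (zdGraph d) p with hP
  set q : ℝ≥0∞ := ENNReal.ofReal ((1 - p) / p) with hq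
  set A : Bool → ℝ≥0∞ := fun s => ∑ i : Fin d, (∫⁻ ω, ind (stEv s (x, i)) ω * NN n (x, i) ω ∂P +
    ∫⁻ ω, ind (stEv s (x - Pi.single i 1, i)) ω * NN n (x - Pi.single i 1, i) ω ∂P) with hA
  set B : Bool → ℝ≥0∞ := fun s => ∫⁻ ω, Vw n ω x * (nEv s ω x : ℝ≥0∞) ∂P with hB
  set T := ∑ i : Fin d, (∫⁻ ω, Tgt n (x, i) ω ∂P + ∫⁻ ω, Tgt n (x - Pi.single i 1, i) ω ∂P) with hT
  -- Step 1 summed over the `2d` edges at `x`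
  have h1 : ∀ ℓ : Site d × Fin d, ∫⁻ ω, Tgt n ℓ ω ∂P + q * ∫⁻ ω, ind (stEv true ℓ) ω * NN n ℓ ω ∂P ≤
      ∫⁻ ω, ind (stEv false ℓ) ω * NN n ℓ ω ∂P := by
    intro ℓ
    have h := lintegral_Tgt_add_le n p hp ℓ
    have e1 : ∫⁻ ω, Nop n ℓ ω ∂P = ∫⁻ ω, ind (stEv true ℓ) ω * NN n ℓ ω ∂P := lintegral_congr fun ω => Nop_eq n ℓ ω
    have e2 : ∫⁻ ω, Ncl n ℓ ω ∂P = ∫⁻ ω, ind (stEv false ℓ) ω * NN n ℓ ω ∂P := lintegral_congr fun ω => Ncl_eq n ℓ ω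
    rwa [e1, e2] at h
  have hsum : T + q * A true ≤ A false := by
    simp only [hT, hA, Finset.mul_sum, ← Finset.sum_add_distrib]
    refine Finset.sum_le_sum fun i _ => ?_
    have ha := h1 (x, i)
    have hb := h1 (x - Pi.single i 1, i)
    calc ∫⁻ ω, Tgt n (x, i) ω ∂P + ∫⁻ ω, Tgt n (x - Pi.single i 1, i) ω ∂P +
          q * (∫⁻ ω, ind (stEv true (x, i)) ω * NN n (x, i) ω ∂P +
            ∫⁻ ω, ind (stEv true (x - Pi.single i 1, i)) ω * NN n (x - Pi.single i 1, i) ω ∂P)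
        = (∫⁻ ω, Tgt n (x, i) ω ∂P + q * ∫⁻ ω, ind (stEv true (x, i)) ω * NN n (x, i) ω ∂P) +
          (∫⁻ ω, Tgt n (x - Pi.single i 1, i) ω ∂P +
            q * ∫⁻ ω, ind (stEv true (x - Pi.single i 1, i)) ω * NN n (x - Pi.single i 1, i) ω ∂P) := by ring
      _ ≤ _ := add_le_add ha hb
  -- Step 2: `A s = 2 B s`
  have h2 : ∀ s, A s = 2 * B s := fun s => sum_lintegral_NN_eq s n p x
  -- Step 3: `B false ≤ q B true + (1/p) M'`
  have h3 : B false ≤ q * B true + ENNReal.ofReal (1 / p) * ∫⁻ ω, Mabs n p ω x ∂P := by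
    simp only [hB]
    rw [← lintegral_const_mul _ (measurable_Vw_mul_nEv true n x), ← lintegral_const_mul _ (measurable_Mabs n p x),
      ← lintegral_add_left ((measurable_Vw_mul_nEv true n x).const_mul _)]
    exact lintegral_mono fun ω => Vw_mul_nEv_false_le n hp p.2.2 ω x
  have hfin : q * (2 * B true) ≠ ∞ := by
    refine ENNReal.mul_ne_top ENNReal.ofReal_ne_top (ENNReal.mul_ne_top ENNReal.ofNat_ne_top ?_)
    refine ne_top_of_le_ne_top (b := ∫⁻ _, (2 * d : ℝ≥0∞) ∂P) ?_ (lintegral_mono fun ω => Vw_mul_nEv_le true n ω x)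
    rw [lintegral_const, measure_univ, mul_one]
    exact ENNReal.mul_ne_top ENNReal.ofNat_ne_top (ENNReal.natCast_ne_top d)
  have key : T + q * (2 * B true) ≤ 2 * ENNReal.ofReal (1 / p) * ∫⁻ ω, Mabs n p ω x ∂P + q * (2 * B true) := by
    calc T + q * (2 * B true) = T + q * A true := by rw [h2 true]
      _ ≤ A false := hsum
      _ = 2 * B false := h2 false
      _ ≤ 2 * (q * B true + ENNReal.ofReal (1 / p) * ∫⁻ ω, Mabs n p ω x ∂P) := by gcongr
      _ = 2 * ENNReal.ofReal (1 / p) * ∫⁻ ω, Mabs n p ω x ∂P + q * (2 * B true) := by ring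
  exact ENNReal.le_of_add_le_add_right hfin key

/-! ### Step 5. The second-moment input `E[h_p(C(x))²; |E(C(x))| ≤ N] ≤ p(1-p)N`
(Hutchcroft 2020, proof of Thm. 1.6: `E Z_n² = p(1-p) E[T ∧ n] ≤ p(1-p) n`, via Part A) -/

/-- **`E[h_p(C(x))² ; C(x) finite, |E(C(x))| ≤ N] ≤ p(1-p)·N`**, from the exploration martingale:
on that event the exploration with vertex cap `N + 2` has queried exactly `E(C(x))` after `N`
steps, so its score is `-h_p(C(x))` (`ClusterExploration.score_run_eq`), and `E[Z_N²] ≤ p(1-p)N`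
(`ClusterExploration.integral_score_sq_le`).
[cite: Hutchcroft2020Locality, §3, proof of Thm. 1.6] -/
theorem lintegral_sq_hp_le (p : unitInterval) (x : Site d) (N : ℕ) :
    ∫⁻ ω, {ω : BondConfig (Site d) | (openCluster ω x).Finite ∧ tE ω x ≤ N}.indicator
        (fun ω => ENNReal.ofReal ((hp p ω x) ^ 2)) ω ∂(bondPercolation (zdGraph d) p) ≤
      ENNReal.ofReal (p * (1 - p) * N) := by
  classical
  set P := bondPercolation (zdGraph d) p with hP
  set Z : BondConfig (Site d) → ℝ := fun ω =>
    ClusterExploration.score p (ClusterExploration.run (zdGraph d) (N + 2) x ω N) with hZ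
  have hae : ∀ᵐ ω ∂P, ω ⊆ (zdGraph d).edgeSet := setBernoulli_ae_subset
  have hpt : ∀ᵐ ω ∂P, {ω : BondConfig (Site d) | (openCluster ω x).Finite ∧ tE ω x ≤ N}.indicator
      (fun ω => ENNReal.ofReal ((hp p ω x) ^ 2)) ω ≤ ENNReal.ofReal ((Z ω) ^ 2) := by
    filter_upwards [hae] with ω hω
    by_cases hmem : ω ∈ {ω : BondConfig (Site d) | (openCluster ω x).Finite ∧ tE ω x ≤ N}
    · rw [Set.indicator_of_mem hmem]
      obtain ⟨hf, hN⟩ := hmem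
      have hK : (↑hf.toFinset : Set (Site d)) = openCluster ω x := hf.coe_toFinset
      obtain ⟨h1, h2, h3, -⟩ := stats_eq_of_finite hK.symm
      have hcard : (edgesTouching (zdGraph d) hf.toFinset).card ≤ N := h1 ▸ hN
      have hs := ClusterExploration.score_run_eq (G := zdGraph d) (n := N + 2) p x hω hK hcard le_rfl
      have : Z ω = -hp p ω x := by
        simp only [hZ, hs, hp, h2, h3]
        unfold openEdges closedEdges
        ring
      rw [this, neg_sq]
    · rw [Set.indicator_of_notMem hmem]; exact bot_le
  have hint : Integrable (fun ω => (Z ω) ^ 2) P :=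
    ClusterExploration.integrable_comp_run (G := zdGraph d) (n := N + 2) p x N fun σ => (ClusterExploration.score p σ) ^ 2
  calc ∫⁻ ω, {ω : BondConfig (Site d) | (openCluster ω x).Finite ∧ tE ω x ≤ N}.indicator
        (fun ω => ENNReal.ofReal ((hp p ω x) ^ 2)) ω ∂P
      ≤ ∫⁻ ω, ENNReal.ofReal ((Z ω) ^ 2) ∂P := lintegral_mono_ae hpt
    _ = ENNReal.ofReal (∫ ω, (Z ω) ^ 2 ∂P) :=
        (ofReal_integral_eq_lintegral_ofReal hint (Filter.Eventually.of_forall fun ω => sq_nonneg _)).symm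
    _ ≤ ENNReal.ofReal (p * (1 - p) * N) :=
        ENNReal.ofReal_le_ofReal (ClusterExploration.integral_score_sq_le (G := zdGraph d) (n := N + 2) p x N)

/-! ### Step 4. Cauchy–Schwarz and summation by parts (Hutchcroft 2020, proof of Thm. 1.6,
(3.7)–(3.8), with Doob's inequality replaced by the plain second moment) -/

/-- The Cauchy–Schwarz weight `b(t) = min(1/n, 1/t)` (an upper bound for `w(t)/t`).
[cite: Hutchcroft2020Locality, §3, proof of Thm. 1.6] -/
def bwt (n t : ℕ) : ℝ≥0∞ := min ((n : ℝ≥0∞)⁻¹) ((t : ℝ≥0∞)⁻¹)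

/-- Its square `a(t) = min(1/n², 1/t²)`. [cite: Hutchcroft2020Locality, §3, proof of Thm. 1.6] -/
def awt (n t : ℕ) : ℝ≥0∞ := min ((n : ℝ≥0∞)⁻¹ ^ 2) ((t : ℝ≥0∞)⁻¹ ^ 2)

/-- `b(t)² = a(t)`. [folklore] -/
theorem bwt_sq (n t : ℕ) : bwt n t ^ 2 = awt n t := by
  rw [bwt, awt]
  exact (Monotone.map_min (f := fun x : ℝ≥0∞ => x ^ 2) fun a b h => pow_le_pow_left' h 2)

/-- `a` is antitone. [folklore] -/
theorem awt_antitone (n : ℕ) : Antitone (awt n) := by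
  refine Antitone.min antitone_const fun s t h => pow_le_pow_left' (ENNReal.inv_le_inv.2 (by exact_mod_cast h)) 2
  
/-- `a(t) → 0`. [folklore] -/
theorem awt_tendsto_zero (n : ℕ) : Tendsto (awt n) atTop (𝓝 0) := by
  have h1 : Tendsto (fun t : ℕ => ((t : ℝ≥0∞)⁻¹) ^ 2) atTop (𝓝 0) := by
    have := ENNReal.Tendsto.pow (n := 2) ENNReal.tendsto_inv_nat_nhds_zero
    simpa using this
  have h2 : Tendsto (fun _ : ℕ => (n : ℝ≥0∞)⁻¹ ^ 2) atTop (𝓝 ((n : ℝ≥0∞)⁻¹ ^ 2)) := tendsto_const_nhds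
  have h3 := h2.min h1
  rw [min_eq_right (show (0 : ℝ≥0∞) ≤ (n : ℝ≥0∞)⁻¹ ^ 2 from bot_le)] at h3
  exact h3

open Classical in
/-- The Cauchy–Schwarz integrand `F = 1(C(x) finite)·b(|E(C(x))|)·|h_p(C(x))|`.
[cite: Hutchcroft2020Locality, §3, proof of Thm. 1.6] -/
def F4 (n : ℕ) (p : ℝ) (ω : BondConfig (Site d)) (x : Site d) : ℝ≥0∞ :=
  if (openCluster ω x).Finite then bwt n (tE ω x) * ENNReal.ofReal |hp p ω x| else 0

open Classical in
/-- `F` is measurable. [folklore] -/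
theorem measurable_F4 (n : ℕ) (p : ℝ) (x : Site d) : Measurable fun ω : BondConfig (Site d) => F4 n p ω x :=
  measurable_finStats (d := d) x (c := (0 : ℝ≥0∞))
    (fun t nop ncl _ => bwt n t * ENNReal.ofReal |p * ncl - (1 - p) * nop|)

/-- `w(t)/k ≤ 2d·min(1/n, 1/t)` when `1 ≤ t ≤ 2dk` (real form). [folklore] -/
theorem wt_div_le {n t k : ℕ} (hn : 1 ≤ n) (ht : 1 ≤ t) (hk : 1 ≤ k) (htk : t ≤ 2 * d * k) :
    wt n t / k ≤ 2 * d * min (1 / (n : ℝ)) (1 / (t : ℝ)) := by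
  have hk0 : (0 : ℝ) < k := by exact_mod_cast hk
  have ht0 : (0 : ℝ) < t := by exact_mod_cast ht
  have hn0 : (0 : ℝ) < n := by exact_mod_cast hn
  have htk' : (t : ℝ) ≤ 2 * d * k := by exact_mod_cast htk
  rw [mul_min_of_nonneg _ _ (by positivity), le_min_iff]
  constructor
  · -- `w(t)/k ≤ (t/n)/k ≤ 2d/n`
    calc wt n t / k ≤ ((t : ℝ) / n) / k := div_le_div_of_nonneg_right (wt_le_div n t) hk0.le
      _ ≤ (2 * d * k / n) / k := by gcongr
      _ = 2 * d * (1 / (n : ℝ)) := by field_simp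
  · -- `w(t)/k ≤ 1/k ≤ 2d/t`
    calc wt n t / k ≤ 1 / k := div_le_div_of_nonneg_right (wt_le_one n t) hk0.le
      _ ≤ 2 * d * (1 / (t : ℝ)) := by
          rw [mul_one_div, div_le_div_iff₀ hk0 ht0, one_mul]
          exact htk'

/-- **`Mabs ≤ 2d·F`** pointwise (`d ≥ 1`, `n ≥ 1`): `w(|E(K)|)/|K| ≤ 2d·min(1/n, 1/|E(K)|)` since
`|E(K)| ≤ 2d|K|`, `w ≤ 1` and `w(t) ≤ t/n`. [cite: Hutchcroft2020Locality, §3, proof of Thm. 1.6] -/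
theorem Mabs_le (hd : 1 ≤ d) {n : ℕ} (hn : 1 ≤ n) (p : ℝ) (ω : BondConfig (Site d)) (x : Site d) :
    Mabs n p ω x ≤ 2 * d * F4 n p ω x := by
  by_cases hf : (openCluster ω x).Finite
  · rw [Mabs, Vw_of_finite hf, F4, if_pos hf, ← mul_assoc]
    gcongr
    have hk : 1 ≤ nK ω x := by
      rw [nK, Nat.one_le_iff_ne_zero, Ne, Set.ncard_eq_zero hf]
      exact fun h => by simpa [h] using mem_openCluster_self ω x
    have ht : 1 ≤ tE ω x := one_le_ncard_touch hd hf (mem_openCluster_self ω x)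
    have htk : tE ω x ≤ 2 * d * nK ω x := ncard_touch_le hf
    have hreal := wt_div_le (d := d) hn ht hk htk
    have hk0 : (0 : ℝ) < nK ω x := by exact_mod_cast hk
    have ht0 : (0 : ℝ) < tE ω x := by exact_mod_cast ht
    have hn0 : (0 : ℝ) < n := by exact_mod_cast hn
    calc ENNReal.ofReal (wt n (tE ω x)) / (nK ω x : ℝ≥0∞)
        = ENNReal.ofReal (wt n (tE ω x) / nK ω x) := by
          rw [ENNReal.ofReal_div_of_pos hk0, ENNReal.ofReal_natCast]
      _ ≤ ENNReal.ofReal (2 * d * min (1 / (n : ℝ)) (1 / (tE ω x : ℝ))) := ENNReal.ofReal_le_ofReal hreal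
      _ = 2 * d * bwt n (tE ω x) := by
          rw [ENNReal.ofReal_mul (by positivity), ENNReal.ofReal_mono.map_min, one_div, one_div,
            ENNReal.ofReal_inv_of_pos hn0, ENNReal.ofReal_inv_of_pos ht0, ENNReal.ofReal_natCast,
            ENNReal.ofReal_natCast, bwt]
          congr 1
          rw [show (2 * d : ℝ) = ((2 * d : ℕ) : ℝ) by push_cast; ring, ENNReal.ofReal_natCast]
          push_cast; ring
  · rw [Mabs, Vw_of_infinite hf, zero_mul]; exact bot_le

/-- **`(E F)² ≤ 2p(1-p)/n`** (Cauchy–Schwarz, summation by parts against the second-moment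
bound of Step 5, and `Σ_t min(1/n², 1/t²) ≤ 2/n`).
[cite: Hutchcroft2020Locality, §3, proof of Thm. 1.6] -/
theorem lintegral_F4_sq_le {n : ℕ} (hn : 1 ≤ n) (p : unitInterval) (x : Site d) :
    (∫⁻ ω, F4 n p ω x ∂(bondPercolation (zdGraph d) p)) ^ 2 ≤ ENNReal.ofReal (2 * p * (1 - p) / n) := by
  classical
  set P := bondPercolation (zdGraph d) p with hP
  -- the stopping functional `τ = |E(C(x))|` and `X = 1(C(x) finite) h_p²`
  set τ : BondConfig (Site d) → ℕ := fun ω => if (openCluster ω x).Finite then tE ω x else 0 with hτ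
  set X : BondConfig (Site d) → ℝ≥0∞ := fun ω =>
    if (openCluster ω x).Finite then ENNReal.ofReal ((hp p ω x) ^ 2) else 0 with hX
  have hτm : Measurable τ := measurable_finStats (d := d) x (c := (0 : ℕ)) fun t _ _ _ => t
  have hXm : Measurable X :=
    measurable_finStats (d := d) x (c := (0 : ℝ≥0∞)) fun _ nop ncl _ => ENNReal.ofReal ((p * ncl - (1 - p) * nop) ^ 2)
  have hsq : ∀ ω, F4 n p ω x ^ 2 = awt n (τ ω) * X ω := by
    intro ω
    by_cases hf : (openCluster ω x).Finite
    · simp only [F4, hτ, hX, if_pos hf]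
      rw [mul_pow, bwt_sq, ← ENNReal.ofReal_pow (abs_nonneg _), sq_abs]
    · simp only [F4, hτ, hX, if_neg hf]; simp
  have hC : ∀ N : ℕ, ∫⁻ ω, {ω | τ ω ≤ N}.indicator X ω ∂P ≤ ENNReal.ofReal (p * (1 - p)) * N := by
    intro N
    have heq : ∀ ω, {ω | τ ω ≤ N}.indicator X ω =
        {ω : BondConfig (Site d) | (openCluster ω x).Finite ∧ tE ω x ≤ N}.indicator
          (fun ω => ENNReal.ofReal ((hp p ω x) ^ 2)) ω := by
      intro ω
      by_cases hf : (openCluster ω x).Finite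
      · by_cases hN : tE ω x ≤ N
        · rw [Set.indicator_of_mem (show ω ∈ {ω | τ ω ≤ N} by simp [hτ, hf, hN]),
            Set.indicator_of_mem (show ω ∈ {ω : BondConfig (Site d) | (openCluster ω x).Finite ∧ tE ω x ≤ N}
              from ⟨hf, hN⟩)]
          simp [hX, hf]
        · rw [Set.indicator_of_notMem (show ω ∉ {ω | τ ω ≤ N} by simp [hτ, hf, hN]),
            Set.indicator_of_notMem (show ω ∉ {ω : BondConfig (Site d) | (openCluster ω x).Finite ∧ tE ω x ≤ N}
              from fun h => hN h.2)]
      · have : X ω = 0 := by simp [hX, hf]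
        rw [Set.indicator_of_notMem (show ω ∉ {ω : BondConfig (Site d) | (openCluster ω x).Finite ∧ tE ω x ≤ N}
          from fun h => hf h.1)]
        by_cases hm : ω ∈ {ω | τ ω ≤ N}
        · rw [Set.indicator_of_mem hm, this]
        · rw [Set.indicator_of_notMem hm]
    calc ∫⁻ ω, {ω | τ ω ≤ N}.indicator X ω ∂P
        = ∫⁻ ω, {ω : BondConfig (Site d) | (openCluster ω x).Finite ∧ tE ω x ≤ N}.indicator
            (fun ω => ENNReal.ofReal ((hp p ω x) ^ 2)) ω ∂P := lintegral_congr heq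
      _ ≤ ENNReal.ofReal (p * (1 - p) * N) := lintegral_sq_hp_le p x N
      _ = ENNReal.ofReal (p * (1 - p)) * N := by
          rw [ENNReal.ofReal_mul (mul_nonneg p.2.1 (sub_nonneg.2 p.2.2)), ENNReal.ofReal_natCast]
  calc (∫⁻ ω, F4 n p ω x ∂P) ^ 2 ≤ ∫⁻ ω, F4 n p ω x ^ 2 ∂P := lintegral_sq_le P (measurable_F4 n p x).aemeasurable
    _ = ∫⁻ ω, awt n (τ ω) * X ω ∂P := lintegral_congr hsq
    _ ≤ ENNReal.ofReal (p * (1 - p)) * ∑' t, awt n (t + 1) :=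
        lintegral_weight_le P (awt_antitone n) (awt_tendsto_zero n) hXm hτm hC
    _ ≤ ENNReal.ofReal (p * (1 - p)) * (2 * (n : ℝ≥0∞)⁻¹) := by
        gcongr
        have := tsum_min_inv_sq_le hn
        simpa [awt] using this
    _ = ENNReal.ofReal (2 * p * (1 - p) / n) := by
        have hn0 : (0 : ℝ) < n := by exact_mod_cast hn
        rw [← ENNReal.ofReal_natCast n, ← ENNReal.ofReal_inv_of_pos hn0, ← ENNReal.ofReal_ofNat,
          ← ENNReal.ofReal_mul (by norm_num), ← ENNReal.ofReal_mul (mul_nonneg p.2.1 (sub_nonneg.2 p.2.2))]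
        congr 1
        field_simp

/-! ### Step 6. Corollary 1.7 (Hutchcroft 2020, proof of Cor. 1.7, p. 9): remove the weights -/

/-- The two-arm event of Corollary 1.7 at the edge with label `ℓ = {a, b}`:
`e` closed, `a ↮ b`, both clusters touch at least `n` edges, at least one of them is finite.
[cite: Hutchcroft2020Locality, Cor. 1.7 (proof, §3 p. 9)] -/
def twoArm (n : ℕ) (ℓ : Site d × Fin d) : Set (BondConfig (Site d)) :=
  {ω | edgeOf ℓ ∉ ω ∧ headOf ℓ ∉ openCluster ω ℓ.1 ∧
    (n : ℕ∞) ≤ (touch (zdGraph d) (openCluster ω ℓ.1)).encard ∧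
    (n : ℕ∞) ≤ (touch (zdGraph d) (openCluster ω (headOf ℓ))).encard ∧
    ((openCluster ω ℓ.1).Finite ∨ (openCluster ω (headOf ℓ)).Finite)}

open Classical in
/-- `{n ≤ |E(C(x))|}` is measurable (`d ≥ 1`: an infinite cluster touches infinitely many edges).
[folklore] -/
theorem measurableSet_le_encard_touch (hd : 1 ≤ d) (n : ℕ) (x : Site d) :
    MeasurableSet {ω : BondConfig (Site d) | (n : ℕ∞) ≤ (touch (zdGraph d) (openCluster ω x)).encard} := by
  have h := measurable_finStats (d := d) (β := Prop) x (c := True) (fun t _ _ _ => n ≤ t)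
  have hset : {ω : BondConfig (Site d) | (n : ℕ∞) ≤ (touch (zdGraph d) (openCluster ω x)).encard} =
      {ω | if (openCluster ω x).Finite then n ≤ tE ω x else True} := by
    ext ω
    simp only [Set.mem_setOf_eq]
    by_cases hf : (openCluster ω x).Finite
    · rw [if_pos hf, tE, ← (touch_finite hf).cast_ncard_eq, Nat.cast_le]
    · rw [if_neg hf, (touch_infinite hd hf).encard_eq]
      simp
  rw [hset]
  exact measurableSet_setOf.2 h

/-- The two-arm event is measurable. [folklore] -/
theorem measurableSet_twoArm (hd : 1 ≤ d) (n : ℕ) (ℓ : Site d × Fin d) : MeasurableSet (twoArm (d := d) n ℓ) := by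
  have : twoArm (d := d) n ℓ = {ω | edgeOf ℓ ∉ ω} ∩ ({ω | headOf ℓ ∈ openCluster ω ℓ.1}ᶜ ∩
      ({ω | (n : ℕ∞) ≤ (touch (zdGraph d) (openCluster ω ℓ.1)).encard} ∩
        ({ω | (n : ℕ∞) ≤ (touch (zdGraph d) (openCluster ω (headOf ℓ))).encard} ∩
          ({ω | (openCluster ω ℓ.1).Finite} ∪ {ω | (openCluster ω (headOf ℓ)).Finite})))) := by
    ext ω; simp [twoArm]
  rw [this]
  exact (measurableSet_notMem _).inter ((measurableSet_mem_openCluster _ _).compl.inter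
    ((measurableSet_le_encard_touch hd n _).inter ((measurableSet_le_encard_touch hd n _).inter
      ((measurableSet_finite_openCluster _).union (measurableSet_finite_openCluster _)))))

/-- On the two-arm event each weight is at least `w(n)`.
[cite: Hutchcroft2020Locality, Cor. 1.7 (proof, §3 p. 9)] -/
theorem ofReal_wt_le_Wfin {n : ℕ} {ω : BondConfig (Site d)} {x : Site d}
    (h : (n : ℕ∞) ≤ (touch (zdGraph d) (openCluster ω x)).encard) :
    ENNReal.ofReal (wt n n) ≤ Wfin n ω x := by
  by_cases hf : (openCluster ω x).Finite
  · rw [Wfin_of_finite hf]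
    refine ENNReal.ofReal_le_ofReal (wt_mono n ?_)
    rw [← (touch_finite hf).cast_ncard_eq, Nat.cast_le] at h
    exact h
  · rw [Wfin_of_infinite hf]
    exact ENNReal.ofReal_le_one.2 (wt_le_one _ _)

/-- **Removing the weights** (Hutchcroft 2020, proof of Cor. 1.7: `P(S_{e,n})(1-e^{-hn})² ≤ P(T_e)`,
here without FKG since the weights are deterministic): `w(n)²·P(twoArm) ≤ E[Tgt_e]`.
[cite: Hutchcroft2020Locality, Cor. 1.7 (proof, §3 p. 9)] -/
theorem sq_mul_measure_twoArm_le (hd : 1 ≤ d) (n : ℕ) (p : unitInterval) (ℓ : Site d × Fin d) :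
    ENNReal.ofReal (wt n n) ^ 2 * bondPercolation (zdGraph d) p (twoArm n ℓ) ≤
      ∫⁻ ω, Tgt n ℓ ω ∂(bondPercolation (zdGraph d) p) := by
  rw [← lintegral_indicator_const (measurableSet_twoArm hd n ℓ)]
  refine lintegral_mono fun ω => ?_
  by_cases hω : ω ∈ twoArm n ℓ
  · rw [Set.indicator_of_mem hω]
    obtain ⟨h1, h2, h3, h4, h5⟩ := hω
    rw [Tgt, ind_of_mem (show ω ∈ {ω | edgeOf ℓ ∉ ω} from h1), ind_of_mem (show ω ∈ {ω | headOf ℓ ∉ openCluster ω ℓ.1} from h2),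
      ind_of_mem (show ω ∈ {ω | (openCluster ω ℓ.1).Finite ∨ (openCluster ω (headOf ℓ)).Finite} from h5),
      one_mul, one_mul, one_mul, sq]
    exact mul_le_mul' (ofReal_wt_le_Wfin h3) (ofReal_wt_le_Wfin h4)
  · rw [Set.indicator_of_notMem hω]; exact bot_le

/-- **The two-ghost bound at a labelled edge** (Steps 1–5 assembled): for `d, n ≥ 1`, `0 < p`,
`P(twoArm) ≤ 32·d·√((1-p)/(pn))`. [cite: Hutchcroft2020Locality, Cor. 1.7 (proof, §3 p. 9)] -/
theorem measureReal_twoArm_le (hd : 1 ≤ d) {n : ℕ} (hn : 1 ≤ n) (p : unitInterval) (hp0 : 0 < (p : ℝ))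
    (x : Site d) (ℓ : Site d × Fin d) (hℓ : ∃ i : Fin d, ℓ = (x, i) ∨ ℓ = (x - Pi.single i 1, i)) :
    (bondPercolation (zdGraph d) p).real (twoArm n ℓ) ≤ 32 * d * Real.sqrt ((1 - p) / (p * n)) := by
  set P := bondPercolation (zdGraph d) p with hP
  set s2 : ℝ := Real.sqrt (2 * p * (1 - p) / n) with hs2
  set r : ℝ := Real.sqrt ((1 - p) / (p * n)) with hr
  have hp1 : (p : ℝ) ≤ 1 := p.2.2
  -- the chain of Steps 1–5 in `ℝ≥0∞`
  have hF4 : ∫⁻ ω, F4 n p ω x ∂P ≤ ENNReal.ofReal s2 := by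
    have h := lintegral_F4_sq_le (d := d) hn p x
    rw [← Real.sq_sqrt (show (0 : ℝ) ≤ 2 * p * (1 - p) / n by positivity), ENNReal.ofReal_pow (Real.sqrt_nonneg _)] at h
    exact (ENNReal.pow_le_pow_left_iff two_ne_zero).1 h
  have hTsum : ∫⁻ ω, Tgt n ℓ ω ∂P ≤ ∑ i : Fin d, (∫⁻ ω, Tgt n (x, i) ω ∂P + ∫⁻ ω, Tgt n (x - Pi.single i 1, i) ω ∂P) := by
    obtain ⟨i, hi | hi⟩ := hℓ
    · calc ∫⁻ ω, Tgt n ℓ ω ∂P ≤ ∫⁻ ω, Tgt n (x, i) ω ∂P + ∫⁻ ω, Tgt n (x - Pi.single i 1, i) ω ∂P := by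
            rw [hi]; exact le_self_add
        _ ≤ _ := Finset.single_le_sum (f := fun i => ∫⁻ ω, Tgt n (x, i) ω ∂P + ∫⁻ ω, Tgt n (x - Pi.single i 1, i) ω ∂P)
            (fun _ _ => bot_le) (Finset.mem_univ i)
    · calc ∫⁻ ω, Tgt n ℓ ω ∂P ≤ ∫⁻ ω, Tgt n (x, i) ω ∂P + ∫⁻ ω, Tgt n (x - Pi.single i 1, i) ω ∂P := by
            rw [hi]; exact le_add_self
        _ ≤ _ := Finset.single_le_sum (f := fun i => ∫⁻ ω, Tgt n (x, i) ω ∂P + ∫⁻ ω, Tgt n (x - Pi.single i 1, i) ω ∂P)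
            (fun _ _ => bot_le) (Finset.mem_univ i)
  have hchain : ENNReal.ofReal (wt n n) ^ 2 * P (twoArm n ℓ) ≤
      2 * ENNReal.ofReal (1 / p) * (2 * d * ENNReal.ofReal s2) := by
    calc ENNReal.ofReal (wt n n) ^ 2 * P (twoArm n ℓ) ≤ ∫⁻ ω, Tgt n ℓ ω ∂P := sq_mul_measure_twoArm_le hd n p ℓ
      _ ≤ _ := hTsum
      _ ≤ 2 * ENNReal.ofReal (1 / p) * ∫⁻ ω, Mabs n p ω x ∂P := sum_lintegral_Tgt_le n p hp0 x
      _ ≤ 2 * ENNReal.ofReal (1 / p) * ∫⁻ ω, 2 * d * F4 n p ω x ∂P := by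
          gcongr with ω
          exact Mabs_le hd hn p ω x
      _ = 2 * ENNReal.ofReal (1 / p) * (2 * d * ∫⁻ ω, F4 n p ω x ∂P) := by
          rw [lintegral_const_mul _ (measurable_F4 n p x)]
      _ ≤ 2 * ENNReal.ofReal (1 / p) * (2 * d * ENNReal.ofReal s2) := by gcongr
  -- pass to real numbers
  have hfin : 2 * ENNReal.ofReal (1 / p) * (2 * d * ENNReal.ofReal s2) ≠ ∞ := by
    refine ENNReal.mul_ne_top (ENNReal.mul_ne_top ENNReal.ofNat_ne_top ENNReal.ofReal_ne_top)
      (ENNReal.mul_ne_top (ENNReal.mul_ne_top ENNReal.ofNat_ne_top (ENNReal.natCast_ne_top d)) ENNReal.ofReal_ne_top)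
  have hreal := ENNReal.toReal_mono hfin hchain
  have hw0 : 0 ≤ wt n n := wt_nonneg n n
  have hs20 : 0 ≤ s2 := Real.sqrt_nonneg _
  rw [ENNReal.toReal_mul, ENNReal.toReal_pow, ENNReal.toReal_ofReal hw0] at hreal
  simp only [ENNReal.toReal_mul, ENNReal.toReal_ofNat, ENNReal.toReal_natCast,
    ENNReal.toReal_ofReal (show (0 : ℝ) ≤ 1 / p by positivity), ENNReal.toReal_ofReal hs20] at hreal
  change wt n n ^ 2 * P.real (twoArm n ℓ) ≤ 2 * (1 / p) * (2 * d * s2) at hreal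
  -- `w(n) ≥ 1/2`, `s2 ≤ 2 p r`
  have hw : (1 / 2 : ℝ) ≤ wt n n := half_le_wt_self hn
  have hPnn : 0 ≤ P.real (twoArm n ℓ) := measureReal_nonneg
  have hsr : s2 ≤ 2 * p * r := by
    rw [hs2, Real.sqrt_le_left (by positivity), mul_pow, mul_pow, hr,
      Real.sq_sqrt (show (0 : ℝ) ≤ (1 - p) / (p * n) by positivity)]
    have hn0 : (0 : ℝ) < n := by exact_mod_cast hn
    rw [div_le_iff₀ hn0]
    have : (2 : ℝ) ^ 2 * (p : ℝ) ^ 2 * ((1 - p) / (p * n)) * n = 4 * p * (1 - p) := by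
      field_simp
      ring
    rw [this]
    nlinarith [mul_nonneg hp0.le (sub_nonneg.2 hp1)]
  have hd0 : (0 : ℝ) ≤ d := Nat.cast_nonneg d
  have hr0 : 0 ≤ r := Real.sqrt_nonneg _
  -- `P ≤ 4 · (4 d s2 / p) ≤ 32 d r`
  have hw2 : (1 / 4 : ℝ) ≤ wt n n ^ 2 := by nlinarith
  have h1 : P.real (twoArm n ℓ) ≤ 4 * (2 * (1 / p) * (2 * d * s2)) := by
    have := mul_le_mul_of_nonneg_right hw2 hPnn
    linarith
  calc P.real (twoArm n ℓ) ≤ 4 * (2 * (1 / p) * (2 * d * s2)) := h1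
    _ = 16 * d * (s2 / p) := by ring
    _ ≤ 16 * d * (2 * r) := by
        gcongr
        rw [div_le_iff₀ hp0]
        linarith
    _ = 32 * d * r := by ring

end Main

end TwoGhost

/-! ## The discharge -/

open TwoGhost LatticeModels in
/-- **Hutchcroft's two-ghost inequality in ghost-free form on `ℤ^d`** (Ann. Probab. 48 (2020),
arXiv:1808.08940, Corollary 1.7, p. 6), discharged: for `d ≥ 1`, `p ∈ (0, 1]`, `n ≥ 1` and an
edge `e = {x, y}` of `ℤ^d`, the probability that `e` is closed, `x ↮ y`, both `C(x)` and `C(y)`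
touch at least `n` edges and one of them is finite is at most `66·(2d)·√((1-p)/(pn))` (we prove
the bound with `32·d` in place of `66·2d`). Proof: §3 of the source specialised to the
translation group of `ℤ^d` — Lemma 3.1 (the pointwise identity at `e`, resampling of `e`, and
the mass-transport principle, `TwoGhost.sum_lintegral_Tgt_le`), the exploration martingale of
the proof of Thm. 1.6 (`ClusterExploration.integral_score_sq_le`, `TwoGhost.lintegral_sq_hp_le`)
with Cauchy–Schwarz and a summation by parts in place of the dyadic Doob argument
(`TwoGhost.lintegral_F4_sq_le`), and the proof of Cor. 1.7 with `h = 1/n`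
(`TwoGhost.measureReal_twoArm_le`); the ghost field is integrated out throughout (weights
`w(K) = 1 - e^{-|E(K)|/n}`). [cite: Hutchcroft2020Locality, Corollary 1.7 (proof: §3, Lemma 3.1, Thm. 1.6)] -/
theorem Hutchcroft2020_twoGhost_corollary_holds : Hutchcroft2020_twoGhost_corollary := by
  intro d hd p hp0 n hn x y hxy
  have hr0 : 0 ≤ Real.sqrt ((1 - p) / (p * n)) := Real.sqrt_nonneg _
  have hd0 : (0 : ℝ) ≤ d := Nat.cast_nonneg d
  obtain ⟨i, hi | hi⟩ := (zdGraph_adj_iff x y).1 hxy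
  · -- `y = x + eᵢ`: the edge has label `(x, i)`
    have hS : {ω : BondConfig (Site d) | s(x, y) ∉ ω ∧ ¬ (openGraph ω).Reachable x y ∧
        (n : ℕ∞) ≤ {e ∈ (zdGraph d).edgeSet | ∃ v ∈ e, v ∈ openCluster ω x}.encard ∧
        (n : ℕ∞) ≤ {e ∈ (zdGraph d).edgeSet | ∃ v ∈ e, v ∈ openCluster ω y}.encard ∧
        ((openCluster ω x).Finite ∨ (openCluster ω y).Finite)} = twoArm n (x, i) := by
      ext ω
      simp only [twoArm, Set.mem_setOf_eq, edgeOf, headOf, ← hi, touch, openCluster]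
    rw [hS]
    calc (bondPercolation (zdGraph d) p).real (twoArm n (x, i)) ≤ 32 * d * Real.sqrt ((1 - p) / (p * n)) :=
          measureReal_twoArm_le hd hn p hp0 x (x, i) ⟨i, Or.inl rfl⟩
      _ ≤ 66 * (2 * (d : ℝ)) * Real.sqrt ((1 - p) / (p * n)) := by nlinarith [mul_nonneg hd0 hr0]
  · -- `x = y + eᵢ`: the edge has label `(y, i) = (x - eᵢ, i)`
    have hyx : y = x - Pi.single i 1 := by rw [hi, add_sub_cancel_right]
    have hS : {ω : BondConfig (Site d) | s(x, y) ∉ ω ∧ ¬ (openGraph ω).Reachable x y ∧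
        (n : ℕ∞) ≤ {e ∈ (zdGraph d).edgeSet | ∃ v ∈ e, v ∈ openCluster ω x}.encard ∧
        (n : ℕ∞) ≤ {e ∈ (zdGraph d).edgeSet | ∃ v ∈ e, v ∈ openCluster ω y}.encard ∧
        ((openCluster ω x).Finite ∨ (openCluster ω y).Finite)} = twoArm n (y, i) := by
      ext ω
      simp only [twoArm, Set.mem_setOf_eq, edgeOf, headOf, ← hi, touch, openCluster, Sym2.eq_swap (a := x)]
      constructor
      · rintro ⟨h1, h2, h3, h4, h5⟩
        exact ⟨h1, fun h => h2 (SimpleGraph.Reachable.symm h), h4, h3, h5.symm⟩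
      · rintro ⟨h1, h2, h3, h4, h5⟩
        exact ⟨h1, fun h => h2 (SimpleGraph.Reachable.symm h), h4, h3, h5.symm⟩
    rw [hS]
    calc (bondPercolation (zdGraph d) p).real (twoArm n (y, i)) ≤ 32 * d * Real.sqrt ((1 - p) / (p * n)) :=
          measureReal_twoArm_le hd hn p hp0 x (y, i) ⟨i, Or.inr (by rw [hyx])⟩
      _ ≤ 66 * (2 * (d : ℝ)) * Real.sqrt ((1 - p) / (p * n)) := by nlinarith [mul_nonneg hd0 hr0]

end Literature.Probability.Percolation

end
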